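import Literature.Geometry.Lorentzian.CoordRoundDefectEvolution
import Literature.Geometry.Riemannian.CurvatureDerivativeNormSq
import Literature.Geometry.Riemannian.RicciFlowScalarCurvatureEvolution
import Literature.Geometry.Riemannian.CurvatureNormSq
import Literature.Geometry.Riemannian.RicciFlowScalarMaximumPrinciple
import Literature.Geometry.Riemannian.ShiDerivativeMaxPrinciple
import Literature.Geometry.Riemannian.RicciFlowShiEstimates
import Mathlib.Analysis.SpecialFunctions.Pow.Real
import Mathlib.Analysis.SpecialFunctions.Sqrt
import Mathlib.Topology.Order.DenselyOrdered
import Literature.Geometry.Riemannian.CurvatureFamilyRegularity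
import Literature.Geometry.Riemannian.HamiltonPinchedFlowRoundnessRate
import HarnessLib

/-!
# Hamilton's pinched Ricci flow in dimension four, III: the round defect and the decay of all curvature derivatives (re-homed proofs)

**Hamilton's convergence criterion (Hamilton 1986, §5, 5.2) in dimension four — file 3 of 4 of the EXACT discharge of
`Literature.Geometry.Riemannian.hamilton_convergenceCriterion_four`.**  Contents: the evolution inequality of the round defect
(Hamilton 1982, §17, Lemma 17.5; Topping 2006, Prop. 2.5.4); the Bernstein–Shi window lemma (Hamilton 1982, §13; Topping 2006,
Thm. 3.1.1 [Topping2006]); decay of `|∇Rm|²` for a roundening Type-I flow (Hamilton 1982, §17, Thm. 17.6, `k = 1`), the induction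
step for the higher derivatives and the decay of all `|∇ᵏRm|²` (Thm. 17.6) [Hamilton1982].
RE-HOMED into `Literature/` by the Hodge foundations lane (`lit-hodgefound`, seat p20, generation 40): verbatim
DECLARATION-LEVEL ports (the declarations needed, in dependency order; each Part is one Summits module with a neutralised
module docstring) of the theorem-only cone below `Summits/SmoothPoincare4/SmoothPoincare4/Theorems/EntropyRungChangGurskyYangFlowLeafClosed.lean`
(33 modules `EntropyRungMargerinRailsDefs`, `EntropyRungChangGurskyYang{StubInitialFit,StubMaximalFlow,StubInvariantPinching,
StubGradientEstimates*,StubRoundnessRate*,StubCurvatureRatio*,StubLimitRound,StubScaledShi,StubSmoothRoundLimit*,OfBlowupLimit,FlowLeafClosed}`;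
139 declarations in four files `HamiltonPinchedFlowGradientEstimates` → `HamiltonPinchedFlowRoundnessRate` →
`HamiltonPinchedFlowCurvatureDecay` → `HamiltonConvergenceCriterionHolds`), namespace
`Summit.SmoothPoincare4.SmoothPoincare4.Theorems.MargerinRails` re-rooted as `Literature.Geometry.Riemannian.HamiltonPinchedFlow`
(the in-tree `stub_…`/`helper_…` theorem names are kept so that twins have the same short names; they are proved theorems).
Built on the tree's Literature Ricci-flow layer (`Literature/Geometry/Riemannian/RicciFlow*`, `CurvatureNormSq`,
`CurvatureDerivativeNormSq`, `RicciFlowShiEstimates`, `ShiDerivativeMaxPrinciple`, `RicciFlowScalarMaximumPrinciple`,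
`RicciFlowMaximal(Proofs)`, `RicciFlowShortTimeProofs`, `RicciFlowMetricLimit`, `RicciFlowSmoothExtension`, `HamiltonCurvatureODE`,
`HamiltonCurvatureRatio`, `PinchingEstimatesConstraints`, `ChangGurskyYang{Proofs,Regularity,WeylBudget}`, `BonnetMyers`, …) and
`Literature/Geometry/Lorentzian/` (coordinate curvature calculus).  Imports Mathlib/Literature only; no new named fact (D-0026);
every declaration carries the citation of the printed statement it formalises or serves.  The Summits originals stay in place
(transitional duplication).  WHAT THIS IS NOT: nothing here bears on the smooth Poincaré conjecture in dimension four or on any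
summit statement; it is Hamilton's 1982/1986 Ricci-flow analysis on a closed 4-manifold in the tree's vocabulary
(`PseudoRiemannianMetric`, `CovariantDerivative`, `IsRicciFlow` with explicit Levi-Civita witnesses).
-/

noncomputable section

/-!
## Part 1 — port of `Summits/SmoothPoincare4/SmoothPoincare4/Theorems/EntropyRungChangGurskyYangStubSmoothRoundLimitDefect.lean` (6 declarations kept)

# The evolution inequality of the round defect along a Ricci flow on a closed 4-manifold (Hamilton 1982, §17, Lemma 17.5)

Declarations of this Part (verbatim port; each keeps its own docstring and citation): `scalAt_chartRep_eq_of`, `roundDefect_chart_eq`, `roundDefect_contMDiffAt`, `roundDefect_evolution_chart`, `roundDefect_evolution_global`, `helper_roundDefect_evolution`.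

References: R. S. Hamilton, *Three-manifolds with positive Ricci curvature*, J. Differential Geom. 17 (1982) 255–306 [Hamilton1982]; P. Topping, *Lectures on the Ricci flow*, LMS Lecture Note Series 325, CUP 2006 [Topping2006].
-/

section Part1

-- nested operator spaces of metric components (`E →L E →L ℝ` and their derivatives)
set_option maxSynthPendingDepth 3

open _root_.Set _root_.Function _root_.Filter _root_.Module
open scoped _root_.Manifold _root_.ContDiff _root_.Topology

namespace Literature.Geometry.Riemannian.HamiltonPinchedFlow

open Literature.Geometry.Riemannian
open Literature.Geometry.Lorentzian Literature.Geometry.Lorentzian.PseudoRiemannianMetric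
open Literature.Geometry.Lorentzian.MetricCoord

section Manifold

variable {M : Type*} [TopologicalSpace M] [ChartedSpace (EuclideanSpace ℝ (Fin 4)) M]
  [IsManifold (𝓡 4) ∞ M]
  {g : ℝ → PseudoRiemannianMetric (𝓡 4) ∞ (EuclideanSpace ℝ (Fin 4)) (TangentSpace (𝓡 4) : M → Type _)}
  {cov : ℝ → CovariantDerivative (𝓡 4) (EuclideanSpace ℝ (Fin 4)) (TangentSpace (𝓡 4) : M → Type _)}
  {T : ℝ}

/-- **The scalar curvature of the flow read in the chart** on a general time set:
`scalAt (G s) u = R(g s, cov s)(Φ u)` for the Levi-Civita witness `cov s` (the proof of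
`IsRicciFlow.scalAt_chartRep_eq`, which is stated for `[0, T]`). [cite: Topping2006, Prop. 2.5.4] -/
theorem scalAt_chartRep_eq_of {S : Set ℝ} (hflow : IsRicciFlow g cov S) (x₀ : M) {s : ℝ} (hs : s ∈ S)
    (u : chartTarget (𝓡 4) x₀) :
    scalAt (chartRep (𝓡 4) g x₀ s) u = (g s).scalarCurvatureWith (cov s) (chartInv (𝓡 4) x₀ u) := by
  haveI := (g s).hasLeviCivita
  haveI := (chartPullback (𝓡 4) (g s) x₀).hasLeviCivita
  have h2 : (2 : ℕ∞ω) ≤ ∞ := WithTop.coe_le_coe.mpr le_top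
  rw [← OpensChart.scalarCurvature_eq_scalAt (val_chartPullback_eq_chartRep g x₀ s) u,
    (g s).scalarCurvature_comap contMDiff_pullbackBilin_holds (contMDiff_chartInv x₀)
      (injective_mfderiv_chartInv x₀) rfl u,
    scalarCurvatureWith, (hflow.isLeviCivita s hs).ricci_eq_ricci h2]
  rfl

/-- **The round defect read in the chart** (dimension `4`): for the Kulkarni–Nomizu array `A s` of
the chart components `G s = chartRep (𝓡 4) g x₀ s` and `a(s) = (6(T − s))⁻¹`,
`|Rm(G s) − a(s) A s|²(u) = Q − 2R/(3(T − s)) + 2/(3(T − s)²)` at `Φ u`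
(`tnormSq_rm4_sub_smul_ggKN` with `n = 4`, `tnormSq rm4 = |Rm|²`, `scalAt = R`).
[cite: Hamilton1982, §17, Lemma 17.5] -/
theorem roundDefect_chart_eq (hflow : IsRicciFlow g cov (Ico 0 T)) (hR : ∀ s ∈ Ico 0 T, (g s).IsRiemannian)
    {P : ℝ → M → ℝ}
    (hP : ∀ s x, P s x = (g s).curvNormSqWith (cov s) x
      - 2 * (g s).scalarCurvatureWith (cov s) x / (3 * (T - s)) + 2 / (3 * (T - s) ^ 2))
    (x₀ : M) {A : ℝ → (EuclideanSpace ℝ (Fin 4)) → (Fin 4 → Fin (finrank ℝ (EuclideanSpace ℝ (Fin 4)))) → ℝ}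
    (hA : ∀ s y J, A s y J =
      chartRep (𝓡 4) g x₀ s y (finBasis ℝ (EuclideanSpace ℝ (Fin 4)) (J 0)) (finBasis ℝ (EuclideanSpace ℝ (Fin 4)) (J 3))
        * chartRep (𝓡 4) g x₀ s y (finBasis ℝ (EuclideanSpace ℝ (Fin 4)) (J 1)) (finBasis ℝ (EuclideanSpace ℝ (Fin 4)) (J 2))
      - chartRep (𝓡 4) g x₀ s y (finBasis ℝ (EuclideanSpace ℝ (Fin 4)) (J 0)) (finBasis ℝ (EuclideanSpace ℝ (Fin 4)) (J 2))
        * chartRep (𝓡 4) g x₀ s y (finBasis ℝ (EuclideanSpace ℝ (Fin 4)) (J 1)) (finBasis ℝ (EuclideanSpace ℝ (Fin 4)) (J 3)))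
    {s : ℝ} (hs : s ∈ Ico 0 T) (u : chartTarget (𝓡 4) x₀) :
    P s (chartInv (𝓡 4) x₀ u) = tnormSq (chartRep (𝓡 4) g x₀ s) (finBasis ℝ (EuclideanSpace ℝ (Fin 4)))
      (rm4 (chartRep (𝓡 4) g x₀ s) (finBasis ℝ (EuclideanSpace ℝ (Fin 4))) - (6 * (T - s))⁻¹ • A s) u := by
  have hGs : IsMetricOn (chartRep (𝓡 4) g x₀ s) (extChartAt (𝓡 4) x₀).target := isMetricOn_chartRep g x₀ s
  have hsy := hGs.symm u u.2
  have hpos : ∀ v : (EuclideanSpace ℝ (Fin 4)), v ≠ 0 → 0 < chartRep (𝓡 4) g x₀ s u v v := fun v hv ↦ chartRep_pos (hR s hs) x₀ u v hv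
  have hn : (Fintype.card (Fin (finrank ℝ (EuclideanSpace ℝ (Fin 4)))) : ℝ) = 4 := by
    rw [Fintype.card_fin, finrank_euclideanSpace_fin]
    norm_num
  have hTs : T - s ≠ 0 := sub_ne_zero.2 (ne_of_gt hs.2)
  rw [tnormSq_rm4_sub_smul_ggKN (finBasis ℝ (EuclideanSpace ℝ (Fin 4))) (hA s) hsy hpos, hn,
    hGs.tnormSq_rm4_eq_rmNormSqAt (finBasis ℝ (EuclideanSpace ℝ (Fin 4))) u.2 hpos,
    ← curvNormSqWith_chartInv_eq (hflow.isLeviCivita s hs) x₀ u, scalAt_chartRep_eq_of hflow x₀ hs u, hP]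
  field_simp
  ring

/-- **The round defect `P(t, ·)` is `C^∞` on `M`** at times of the flow (its chart representative
is the smooth coordinate function `|Rm − a A|²`). [cite: Topping2006, §1.2.3] -/
theorem roundDefect_contMDiffAt (hT : 0 < T) (hflow : IsRicciFlow g cov (Ico 0 T))
    (hR : ∀ s ∈ Ico 0 T, (g s).IsRiemannian) {P : ℝ → M → ℝ}
    (hP : ∀ s x, P s x = (g s).curvNormSqWith (cov s) x
      - 2 * (g s).scalarCurvatureWith (cov s) x / (3 * (T - s)) + 2 / (3 * (T - s) ^ 2))
    {t : ℝ} (ht : t ∈ Ico 0 T) (x : M) : ContMDiffAt (𝓡 4) 𝓘(ℝ, ℝ) ∞ (P t) x := by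
  have hS : UniqueDiffOn ℝ (Ico 0 T) := uniqueDiffOn_Ico 0 T
  have hS' : Ico 0 T ⊆ closure (interior (Ico 0 T)) := by
    rw [interior_Ico, closure_Ioo hT.ne]
    exact Ico_subset_Icc_self
  set G := chartRep (𝓡 4) g x with hGdef
  set b := finBasis ℝ (EuclideanSpace ℝ (Fin 4)) with hbdef
  set A : ℝ → (EuclideanSpace ℝ (Fin 4)) → (Fin 4 → Fin (finrank ℝ (EuclideanSpace ℝ (Fin 4)))) → ℝ := fun s y J ↦
    G s y (b (J 0)) (b (J 3)) * G s y (b (J 1)) (b (J 2)) - G s y (b (J 0)) (b (J 2)) * G s y (b (J 1)) (b (J 3))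
    with hAdef
  have hA : ∀ s y J, A s y J =
      G s y (b (J 0)) (b (J 3)) * G s y (b (J 1)) (b (J 2)) - G s y (b (J 0)) (b (J 2)) * G s y (b (J 1)) (b (J 3)) :=
    fun _ _ _ ↦ rfl
  have hGt : IsMetricOn (G t) (extChartAt (𝓡 4) x).target :=
    ((hflow.isMetricFamilyOn_chartRep_of hS hS' x).isMetricOn t ht)
  have hDs : TSmoothOn (rm4 (G t) b - (6 * (T - t))⁻¹ • A t) (extChartAt (𝓡 4) x).target :=
    (hGt.tsmoothOn_rm4 b).sub ((hGt.tsmoothOn_ggKN b (hA t)).smul _)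
  exact contMDiffAt_of_chart_eq x (fun u ↦ roundDefect_chart_eq hflow hR hP x hA ht u)
    (hGt.contDiffOn_tnormSq hDs)

/-- **The evolution inequality of the round defect, in one chart** (Hamilton 1982, §17,
Thm. 17.6): for a Ricci flow of Riemannian metrics on `[0, T)`, `T > 0`, and a point `z₀` there is
`C ≥ 0` with `∂ₜP ≤ Δ_{g(t)}P − 2|∇Rm|² + C(Q + (T − t)⁻²)√|P| + C√Q|P|` at every `t ∈ [0, T)`
and every `z` in the source of the chart at `z₀`, `P = Q − 2R/(3(T − t)) + 2/(3(T − t)²)`: the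
coordinate inequality `derivWithin_tnormSq_roundDefect_le` with `a = (6(T − t))⁻¹`
(`|a'| = (T − t)⁻²/6`, `|a|√Q ≤ (Q + (T − t)⁻²)/2`), transported by the chart dictionary.
[cite: Hamilton1982, §17, Thm. 17.6] -/
theorem roundDefect_evolution_chart (hT : 0 < T) (hflow : IsRicciFlow g cov (Ico 0 T))
    (hR : ∀ s ∈ Ico 0 T, (g s).IsRiemannian) {P : ℝ → M → ℝ}
    (hP : ∀ s x, P s x = (g s).curvNormSqWith (cov s) x
      - 2 * (g s).scalarCurvatureWith (cov s) x / (3 * (T - s)) + 2 / (3 * (T - s) ^ 2)) (z₀ : M) :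
    ∃ C : ℝ, 0 ≤ C ∧ ∀ t ∈ Ico 0 T, ∀ z ∈ (extChartAt (𝓡 4) z₀).source,
      derivWithin (fun s ↦ P s z) (Ico 0 T) t ≤ (g t).laplaceBeltrami (P t) z
        - 2 * curvDerivNormSq (𝓡 4) g 1 t z
        + C * ((g t).curvNormSqWith (cov t) z + ((T - t) ^ 2)⁻¹) * Real.sqrt |P t z|
        + C * Real.sqrt ((g t).curvNormSqWith (cov t) z) * |P t z| := by
  have hS : UniqueDiffOn ℝ (Ico 0 T) := uniqueDiffOn_Ico 0 T
  have hS' : Ico 0 T ⊆ closure (interior (Ico 0 T)) := by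
    rw [interior_Ico, closure_Ioo hT.ne]
    exact Ico_subset_Icc_self
  have ht₀ : (0 : ℝ) ∈ Ico 0 T := ⟨le_rfl, hT⟩
  set G := chartRep (𝓡 4) g z₀ with hGdef
  set b := finBasis ℝ (EuclideanSpace ℝ (Fin 4)) with hbdef
  have hfam : IsMetricFamilyOn G (Ico 0 T) (extChartAt (𝓡 4) z₀).target :=
    hflow.isMetricFamilyOn_chartRep_of hS hS' z₀
  have hfl : ∀ s ∈ Ico 0 T, ∀ y ∈ (extChartAt (𝓡 4) z₀).target,
      tDeriv G (Ico 0 T) s y = (-2 : ℝ) • ricAt (G s) y :=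
    fun s hs y hy ↦ hflow.tDeriv_chartRep_eq_of hS hS' z₀ hs hy
  set A : ℝ → (EuclideanSpace ℝ (Fin 4)) → (Fin 4 → Fin (finrank ℝ (EuclideanSpace ℝ (Fin 4)))) → ℝ := fun s y J ↦
    G s y (b (J 0)) (b (J 3)) * G s y (b (J 1)) (b (J 2)) - G s y (b (J 0)) (b (J 2)) * G s y (b (J 1)) (b (J 3))
    with hAdef
  have hA : ∀ s y J, A s y J =
      G s y (b (J 0)) (b (J 3)) * G s y (b (J 1)) (b (J 2)) - G s y (b (J 0)) (b (J 2)) * G s y (b (J 1)) (b (J 3)) :=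
    fun _ _ _ ↦ rfl
  have h6 : ∀ s ∈ Ico 0 T, (6 : ℝ) * (T - s) ≠ 0 := fun s hs ↦
    mul_ne_zero (by norm_num) (sub_ne_zero.2 (ne_of_gt hs.2))
  have ha : ContDiffOn ℝ ∞ (fun s ↦ (6 * (T - s))⁻¹) (Ico 0 T) :=
    (contDiffOn_const.mul (contDiffOn_const.sub contDiffOn_id)).inv h6
  obtain ⟨C, hC0, hC⟩ := hfam.derivWithin_tnormSq_roundDefect_le b hfl hA ht₀ ha
  refine ⟨2 * C, by positivity, fun t ht z hz ↦ ?_⟩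
  have two : (2 : ℕ∞ω) ≤ ∞ := WithTop.coe_le_coe.mpr le_top
  have hy : extChartAt (𝓡 4) z₀ z ∈ (extChartAt (𝓡 4) z₀).target := (extChartAt (𝓡 4) z₀).map_source hz
  set u : chartTarget (𝓡 4) z₀ := ⟨extChartAt (𝓡 4) z₀ z, hy⟩ with hudef
  have hΦu : chartInv (𝓡 4) z₀ u = z := (extChartAt (𝓡 4) z₀).left_inv hz
  have hGt := hfam.isMetricOn t ht
  have hsy := hGt.symm u u.2
  have hpos : ∀ v : (EuclideanSpace ℝ (Fin 4)), v ≠ 0 → 0 < G t u v v := fun v hv ↦ chartRep_pos (hR t ht) z₀ u v hv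
  have hTt : 0 < T - t := sub_pos.2 ht.2
  -- (1) the coordinate inequality at `(u, t)`
  have key := hC t ht u u.2 hpos
  set Dt : (EuclideanSpace ℝ (Fin 4)) → (Fin 4 → Fin (finrank ℝ (EuclideanSpace ℝ (Fin 4)))) → ℝ := rm4 (G t) b - (6 * (T - t))⁻¹ • A t with hDt
  set u0 := tnormSq (G t) b (rm4 (G t) b) u with hu0
  set u1 := tnormSq (G t) b (curvD G b 1 t) u with hu1
  set uD := tnormSq (G t) b Dt u with huD
  have hu0n : 0 ≤ u0 := tnormSq_nonneg b hsy hpos _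
  have huDn : 0 ≤ uD := tnormSq_nonneg b hsy hpos _
  -- (2) the dictionary
  have hfun : ∀ s ∈ Ico 0 T, P s z = tnormSq (G s) b (rm4 (G s) b - (6 * (T - s))⁻¹ • A s) u := by
    intro s hs
    have h := roundDefect_chart_eq hflow hR hP z₀ hA hs u
    rwa [hΦu] at h
  have hPtz : P t z = uD := hfun t ht
  have hF1 : curvDerivNormSq (𝓡 4) g 1 t z = u1 := curvDerivNormSq_eq_chart (hR t ht) hz 1
  have hQ : (g t).curvNormSqWith (cov t) z = u0 := by
    rw [← hΦu, curvNormSqWith_chartInv_eq (hflow.isLeviCivita t ht) z₀ u]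
    exact (hGt.tnormSq_rm4_eq_rmNormSqAt b u.2 hpos).symm
  -- (3) the Laplacian
  haveI := (g t).hasLeviCivita
  haveI := (chartPullback (𝓡 4) (g t) z₀).hasLeviCivita
  have hGv := val_chartPullback_eq_chartRep g z₀ t
  have hDts : TSmoothOn Dt (extChartAt (𝓡 4) z₀).target :=
    (hGt.tsmoothOn_rm4 b).sub ((hGt.tsmoothOn_ggKN b (hA t)).smul _)
  have hrep : ∀ u' : chartTarget (𝓡 4) z₀, (P t ∘ chartInv (𝓡 4) z₀) u' = tnormSq (G t) b Dt u' :=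
    fun u' ↦ roundDefect_chart_eq hflow hR hP z₀ hA ht u'
  have hΦc : ContDiffAt ℝ 2 (tnormSq (G t) b Dt) (u : (EuclideanSpace ℝ (Fin 4))) :=
    ((hGt.contDiffOn_tnormSq hDts).contDiffAt ((isOpen_extChartAt_target z₀).mem_nhds u.2)).of_le two
  have hfsmooth : ContMDiffAt (𝓡 4) 𝓘(ℝ, ℝ) 2 (P t) (chartInv (𝓡 4) z₀ u) :=
    (roundDefect_contMDiffAt hT hflow hR hP ht _).of_le two
  have hlap : lapAt (G t) (tnormSq (G t) b Dt) u = (g t).laplaceBeltrami (P t) z := by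
    rw [← OpensChart.dalembertian_eq_lapAt hGv u hrep hΦc,
      (g t).dalembertian_comap contMDiff_pullbackBilin_holds (contMDiff_chartInv z₀)
        (injective_mfderiv_chartInv z₀) rfl hfsmooth, hΦu, laplaceBeltrami_eq_dalembertian]
  -- (4) the coefficient `a(t) = (6(T − t))⁻¹`
  have hah : HasDerivAt (fun s ↦ (6 * (T - s))⁻¹) (-(6 * -1) / (6 * (T - t)) ^ 2) t :=
    (((hasDerivAt_id' t).const_sub T).const_mul 6).inv (h6 t ht)
  have ha'v : derivWithin (fun s ↦ (6 * (T - s))⁻¹) (Ico 0 T) t = ((T - t) ^ 2)⁻¹ / 6 := by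
    rw [hah.hasDerivWithinAt.derivWithin (hS t ht)]
    field_simp
  have hw2n : 0 ≤ ((T - t) ^ 2)⁻¹ := by positivity
  have ha'le : |derivWithin (fun s ↦ (6 * (T - s))⁻¹) (Ico 0 T) t| ≤ ((T - t) ^ 2)⁻¹ := by
    rw [ha'v, abs_of_nonneg (by positivity)]
    linarith
  have hale : |(6 * (T - t))⁻¹| * Real.sqrt u0 ≤ u0 + ((T - t) ^ 2)⁻¹ := by
    rw [abs_of_pos (by positivity)]
    have hsq : Real.sqrt u0 ^ 2 = u0 := Real.sq_sqrt hu0n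
    have hcmp : ((6 * (T - t))⁻¹) ^ 2 ≤ ((T - t) ^ 2)⁻¹ := by
      rw [mul_inv, mul_pow, ← inv_pow]
      nlinarith [sq_nonneg (T - t)⁻¹]
    nlinarith [sq_nonneg ((6 * (T - t))⁻¹ - Real.sqrt u0), Real.sqrt_nonneg u0]
  have hsqD : 0 ≤ Real.sqrt uD := Real.sqrt_nonneg _
  have hcoef : u0 + |derivWithin (fun s ↦ (6 * (T - s))⁻¹) (Ico 0 T) t| + |(6 * (T - t))⁻¹| * Real.sqrt u0 ≤
      2 * (u0 + ((T - t) ^ 2)⁻¹) := by linarith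
  have hw1 := mul_le_mul_of_nonneg_right (mul_le_mul_of_nonneg_left hcoef hC0) hsqD
  have hw2 : 0 ≤ C * Real.sqrt u0 * uD := by positivity
  -- (5) assemble
  calc derivWithin (fun s ↦ P s z) (Ico 0 T) t
      = derivWithin (fun s ↦ tnormSq (G s) b (rm4 (G s) b - (6 * (T - s))⁻¹ • A s) u) (Ico 0 T) t :=
        derivWithin_congr (fun s hs ↦ hfun s hs) (hfun t ht)
    _ ≤ lapAt (G t) (tnormSq (G t) b Dt) u - 2 * u1
        + C * (u0 + |derivWithin (fun s ↦ (6 * (T - s))⁻¹) (Ico 0 T) t| + |(6 * (T - t))⁻¹| * Real.sqrt u0)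
          * Real.sqrt uD
        + C * Real.sqrt u0 * uD := key
    _ ≤ _ := by
        rw [← hlap, hF1, hQ, hPtz, abs_of_nonneg huDn]
        linarith

/-- **The evolution inequality of the round defect on a closed manifold**: one constant for all
`(t, z) ∈ [0, T) × M` (finitely many charts cover `M`). [cite: Hamilton1982, §17, Thm. 17.6] -/
theorem roundDefect_evolution_global [CompactSpace M] (hT : 0 < T) (hflow : IsRicciFlow g cov (Ico 0 T))
    (hR : ∀ s ∈ Ico 0 T, (g s).IsRiemannian) {P : ℝ → M → ℝ}
    (hP : ∀ s x, P s x = (g s).curvNormSqWith (cov s) x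
      - 2 * (g s).scalarCurvatureWith (cov s) x / (3 * (T - s)) + 2 / (3 * (T - s) ^ 2)) :
    ∃ C : ℝ, 0 ≤ C ∧ ∀ t ∈ Ico 0 T, ∀ z : M,
      derivWithin (fun s ↦ P s z) (Ico 0 T) t ≤ (g t).laplaceBeltrami (P t) z
        - 2 * curvDerivNormSq (𝓡 4) g 1 t z
        + C * ((g t).curvNormSqWith (cov t) z + ((T - t) ^ 2)⁻¹) * Real.sqrt |P t z|
        + C * Real.sqrt ((g t).curvNormSqWith (cov t) z) * |P t z| := by
  choose C hC0 hC using fun z₀ : M ↦ roundDefect_evolution_chart hT hflow hR hP z₀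
  obtain ⟨F, hcover⟩ := isCompact_univ.elim_finite_subcover (fun z₀ : M ↦ (extChartAt (𝓡 4) z₀).source)
    (fun z₀ ↦ isOpen_extChartAt_source z₀) fun z _ ↦ mem_iUnion.2 ⟨z, mem_extChartAt_source z⟩
  refine ⟨∑ z₀ ∈ F, C z₀, Finset.sum_nonneg fun z₀ _ ↦ hC0 z₀, fun t ht z ↦ ?_⟩
  obtain ⟨z₀, hz₀F, hz⟩ : ∃ z₀ ∈ F, z ∈ (extChartAt (𝓡 4) z₀).source := by
    simpa only [mem_iUnion, exists_prop] using hcover (mem_univ z)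
  have hle : C z₀ ≤ ∑ z₁ ∈ F, C z₁ := Finset.single_le_sum (fun z₁ _ ↦ hC0 z₁) hz₀F
  have h := hC z₀ t ht z hz
  have hQ0 : 0 ≤ (g t).curvNormSqWith (cov t) z := by
    rw [← curvDerivNormSq_zero_eq (hR t ht) (hflow.isLeviCivita t ht) z]
    exact curvDerivNormSq_nonneg (hR t ht) 0 z
  have hA : 0 ≤ ((g t).curvNormSqWith (cov t) z + ((T - t) ^ 2)⁻¹) * Real.sqrt |P t z| :=
    mul_nonneg (add_nonneg hQ0 (by positivity)) (Real.sqrt_nonneg _)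
  have hB : 0 ≤ Real.sqrt ((g t).curvNormSqWith (cov t) z) * |P t z| :=
    mul_nonneg (Real.sqrt_nonneg _) (abs_nonneg _)
  nlinarith [mul_le_mul_of_nonneg_right hle hA, mul_le_mul_of_nonneg_right hle hB]

end Manifold

/-- **Hamilton 1982, §17 (Thm. 17.6): the evolution inequality of the round defect along a Ricci
flow on a closed smooth 4-manifold.** For a Ricci flow `(g, cov)` of Riemannian metrics on
`[0, T)`, `T > 0`, on a closed 4-manifold there is `C₂ ≥ 0` such that the round defect
`P = Q − 2R/(3(T − t)) + 2/(3(T − t)²)` (`Q = |Rm|² = curvNormSqWith`, `R = scalarCurvatureWith`;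
`P = |Rm − (T − t)⁻¹(g ⊙ g)/6|² ≥ 0`) satisfies, at every `(t, x) ∈ [0, T) × M`,
`∂ₜP ≤ Δ_{g(t)}P − 2|∇Rm|² + C₂(Q + (T − t)⁻²)√|P| + C₂√Q |P|`
(`∂ₜ` within `[0, T)`, `|∇Rm|² = curvDerivNormSq (𝓡 4) g 1`, `Δ = laplaceBeltrami`): the reaction
term of the tensor heat equation vanishes to first order at the round tensor. Step S2 of
`stub_smoothRoundLimit`. [cite: Hamilton1982, §17, Thm. 17.6] [cite: Topping2006, Prop. 3.2.10] -/
theorem helper_roundDefect_evolution : ∀ (M : Type) [TopologicalSpace M] [T2Space M] [SecondCountableTopology M] [ChartedSpace (EuclideanSpace ℝ (Fin 4)) M] [IsManifold (𝓡 4) ∞ M] [CompactSpace M] (g : ℝ → PseudoRiemannianMetric (𝓡 4) ∞ (EuclideanSpace ℝ (Fin 4)) (TangentSpace (𝓡 4) : M → Type _)) (cov : ℝ → CovariantDerivative (𝓡 4) (EuclideanSpace ℝ (Fin 4)) (TangentSpace (𝓡 4) : M → Type _)) (T : ℝ), 0 < T → IsRicciFlow g cov (Ico 0 T) → (∀ t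 ∈ Ico 0 T, (g t).IsRiemannian) → ∃ C₂ : ℝ, 0 ≤ C₂ ∧ ∀ t ∈ Ico 0 T, ∀ x : M, derivWithin (fun s ↦ ((g s).curvNormSqWith (cov s) x - 2 * (g s).scalarCurvatureWith (cov s) x / (3 * (T - s)) + 2 / (3 * (T - s) ^ 2))) (Ico 0 T) t ≤ (g t).laplaceBeltrami (fun y ↦ (g t).curvNormSqWith (cov t) y - 2 * (g t).scalarCurvatureWith (cov t) y / (3 * (T - t)) + 2 / (3 * (T - t) ^ 2)) x - 2 * curvDerivNormSq (𝓡 4) g 1 t x + C₂ * ((g t).curvNormSqWith (cov t) x + ((T - t) ^ 2)⁻¹) * Real.sqrt |((g t).curvNormSqWith (cov t) x - 2 * (g t).scalarCurvatureWith (cov t) x / (3 * (T - t)) + 2 / (3 * (T - t) ^ 2))| + C₂ * Real.sqrt ((g t).curvNormSqWith (cov t) x) * |((g t).curvNormSqWith (cov t) x - 2 * (g t).scalarCurvatureWith (cov t) x / (3 * (T - t)) + 2 / (3 * (T - t) ^ 2))| := by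
  intro M _ _ _ _ _ _ g cov T hT hflow hR
  obtain ⟨C, hC0, hC⟩ := roundDefect_evolution_global (g := g) (cov := cov) hT hflow hR
    (P := fun s x ↦ (g s).curvNormSqWith (cov s) x
      - 2 * (g s).scalarCurvatureWith (cov s) x / (3 * (T - s)) + 2 / (3 * (T - s) ^ 2))
    (fun _ _ ↦ rfl)
  exact ⟨C, hC0, fun t ht x ↦ hC t ht x⟩

end Literature.Geometry.Riemannian.HamiltonPinchedFlow

end Part1

/-!
## Part 2 — port of `Summits/SmoothPoincare4/SmoothPoincare4/Theorems/EntropyRungChangGurskyYangStubSmoothRoundLimitWindow.lean` (2 declarations kept)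

# The Bernstein–Shi window lemma (abstract maximum-principle step; Hamilton 1982, §13; Topping 2006, Thm. 3.1.1)

Declarations of this Part (verbatim port; each keeps its own docstring and citation): `bernsteinWindow_core`, `helper_bernsteinWindow`.

References: R. S. Hamilton, *Three-manifolds with positive Ricci curvature*, J. Differential Geom. 17 (1982) 255–306 [Hamilton1982]; P. Topping, *Lectures on the Ricci flow*, LMS Lecture Note Series 325, CUP 2006 [Topping2006].
-/

section Part2

open _root_.Set _root_.Function _root_.Filter
open scoped _root_.Manifold _root_.ContDiff _root_.Topology

namespace Literature.Geometry.Riemannian.HamiltonPinchedFlow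

open Literature.Geometry.Riemannian
open Literature.Geometry.Lorentzian Literature.Geometry.Lorentzian.PseudoRiemannianMetric

section Core

variable {E : Type*} [NormedAddCommGroup E] [NormedSpace ℝ E] [FiniteDimensional ℝ E]
  [CompleteSpace E] {H : Type*} [TopologicalSpace H] {I : ModelWithCorners ℝ E H}
  [I.Boundaryless] {M : Type*} [TopologicalSpace M] [ChartedSpace H M] [IsManifold I ∞ M]

/-- **The Bernstein–Shi window lemma on `[0, τ]`** (abstract maximum-principle step of
Hamilton 1982, §13 / Topping 2006, Thm. 3.3.1): closed manifold, Riemannian metrics `g t`,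
`f, F ≥ 0` jointly `C^∞` on `M × [0, τ]` with `∂ₜ f ≤ Δ f − θ F + a`, `∂ₜ F ≤ Δ F + K F + b`
(`∂ₜ = derivWithin` within `[0, τ]`), `θ > 0`, `K, a, b ≥ 0`, `K τ ≤ 1`, `f(0, ·) ≤ A₀`. THEN
`t F(t, x) ≤ (2/θ) A₀ + τ (τ b + 2a/θ)` on `M × [0, τ]`: the weak maximum principle
(`weakMaximumPrinciple`, Thm. 3.1.1) for `u = t F + (2/θ) f`, which satisfies
`∂ₜ u ≤ Δ u + (τ b + 2a/θ)`, `u(0, ·) ≤ (2/θ) A₀`.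
[cite: Hamilton1982, §13] [cite: Topping2006, Thm. 3.1.1] -/
theorem bernsteinWindow_core [CompactSpace M]
    {g : ℝ → PseudoRiemannianMetric I ∞ E (TangentSpace I : M → Type _)} {τ θ K a b A₀ : ℝ}
    {f F : ℝ → M → ℝ} (hτ : 0 < τ) (hθ : 0 < θ)
    (hgR : ∀ t ∈ Icc 0 τ, (g t).IsRiemannian)
    (hf : ContMDiffOn (I.prod 𝓘(ℝ, ℝ)) 𝓘(ℝ, ℝ) ∞ (fun p : M × ℝ ↦ f p.2 p.1) (univ ×ˢ Icc 0 τ))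
    (hF : ContMDiffOn (I.prod 𝓘(ℝ, ℝ)) 𝓘(ℝ, ℝ) ∞ (fun p : M × ℝ ↦ F p.2 p.1) (univ ×ˢ Icc 0 τ))
    (hfnn : ∀ t ∈ Icc 0 τ, ∀ x, 0 ≤ f t x) (hFnn : ∀ t ∈ Icc 0 τ, ∀ x, 0 ≤ F t x)
    (hK : 0 ≤ K) (ha : 0 ≤ a) (hb : 0 ≤ b) (hKτ : K * τ ≤ 1) (h0 : ∀ x, f 0 x ≤ A₀)
    (hevf : ∀ t ∈ Icc 0 τ, ∀ x, derivWithin (fun s ↦ f s x) (Icc 0 τ) t ≤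
      (g t).laplaceBeltrami (f t) x - θ * F t x + a)
    (hevF : ∀ t ∈ Icc 0 τ, ∀ x, derivWithin (fun s ↦ F s x) (Icc 0 τ) t ≤
      (g t).laplaceBeltrami (F t) x + K * F t x + b) :
    ∀ t ∈ Icc 0 τ, ∀ x, t * F t x ≤ 2 / θ * A₀ + τ * (τ * b + 2 * a / θ) := by
  have h2le : (2 : ℕ∞ω) ≤ ∞ := WithTop.coe_le_coe.mpr le_top
  have hθ0 : θ ≠ 0 := hθ.ne'
  have hθ' : 0 ≤ 2 / θ := by positivity
  have hDnn : 0 ≤ τ * b + 2 * a / θ := by positivity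
  -- the auxiliary function `u = t F + (2/θ) f`
  set u : ℝ → M → ℝ := fun s x ↦ s * F s x + 2 / θ * f s x with hu
  have husmooth : ContMDiffOn (I.prod 𝓘(ℝ, ℝ)) 𝓘(ℝ, ℝ) ∞ (fun p : M × ℝ ↦ u p.2 p.1)
      (univ ×ˢ Icc 0 τ) := by
    have h1 : ContMDiffOn (I.prod 𝓘(ℝ, ℝ)) 𝓘(ℝ, ℝ) ∞ (fun p : M × ℝ ↦ p.2 * F p.2 p.1)
        (univ ×ˢ Icc 0 τ) := contMDiff_snd.contMDiffOn.mul hF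
    have h2 : ContMDiffOn (I.prod 𝓘(ℝ, ℝ)) 𝓘(ℝ, ℝ) ∞ (fun p : M × ℝ ↦ 2 / θ * f p.2 p.1)
        (univ ×ˢ Icc 0 τ) := contMDiffOn_const.mul hf
    exact h1.add h2
  -- the differential inequality `∂_t u ≤ Δ u + (τ b + 2a/θ)`
  have hineq : ∀ t ∈ Icc 0 τ, ∀ x : M, derivWithin (fun s ↦ u s x) (Icc 0 τ) t ≤
      (g t).laplaceBeltrami (u t) x + mvfderiv I (u t) x ((fun (_ : ℝ) (_ : M) ↦ (0 : E)) t x)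
        + (fun (_ _ : ℝ) ↦ τ * b + 2 * a / θ) (u t x) t := by
    intro t ht x
    have hmv : mvfderiv I (u t) x ((fun (_ : ℝ) (_ : M) ↦ (0 : E)) t x) = 0 := map_zero _
    rw [hmv, add_zero]
    show derivWithin (fun s ↦ u s x) (Icc 0 τ) t ≤
      (g t).laplaceBeltrami (u t) x + (τ * b + 2 * a / θ)
    -- (1) the time derivative of `u`
    have hsf := hasDerivWithinAt_time (n := ∞) (by simp) hf x ht
    have hsF := hasDerivWithinAt_time (n := ∞) (by simp) hF x ht
    set d₁ := derivWithin (fun s ↦ f s x) (Icc 0 τ) t with hd₁def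
    set d₂ := derivWithin (fun s ↦ F s x) (Icc 0 τ) t with hd₂def
    have hdu : HasDerivWithinAt (fun s ↦ u s x) (1 * F t x + t * d₂ + 2 / θ * d₁) (Icc 0 τ) t :=
      ((hasDerivWithinAt_id t _).mul hsF).add (hsf.const_mul (2 / θ))
    rw [hdu.derivWithin (uniqueDiffOn_Icc hτ t ht), one_mul]
    -- (2) the Laplacian of `u(·, t)`
    have hsm₁ : CMDiffAt 2 (F t) x := ((contMDiff_slice hF ht).of_le h2le).contMDiffAt
    have hsm₂ : CMDiffAt 2 (f t) x := ((contMDiff_slice hf ht).of_le h2le).contMDiffAt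
    have hlap : (g t).laplaceBeltrami (u t) x =
        t * (g t).laplaceBeltrami (F t) x + 2 / θ * (g t).laplaceBeltrami (f t) x :=
      laplaceBeltrami_add_mul (g t) hsm₁ hsm₂ t (2 / θ)
    rw [hlap]
    -- (3) the pointwise algebra
    have hq₁ := hevf t ht x
    have hq₂ := hevF t ht x
    rw [← hd₁def] at hq₁
    rw [← hd₂def] at hq₂
    have hFx : 0 ≤ F t x := hFnn t ht x
    have ht0 : 0 ≤ t := ht.1
    have htK : t * K ≤ 1 :=
      calc t * K ≤ τ * K := mul_le_mul_of_nonneg_right ht.2 hK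
        _ = K * τ := mul_comm _ _
        _ ≤ 1 := hKτ
    have hKF : t * K * F t x ≤ F t x := by
      have h := mul_le_mul_of_nonneg_right htK hFx
      rwa [one_mul] at h
    have htb : t * b ≤ τ * b := mul_le_mul_of_nonneg_right ht.2 hb
    have hθF : 2 / θ * (θ * F t x) = 2 * F t x := by
      field_simp
    have hθa : 2 / θ * a = 2 * a / θ := by ring
    generalize (g t).laplaceBeltrami (F t) x = L₁ at hq₂ ⊢
    generalize (g t).laplaceBeltrami (f t) x = L₂ at hq₁ ⊢
    have step1 : t * d₂ ≤ t * (L₁ + K * F t x + b) := mul_le_mul_of_nonneg_left hq₂ ht0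
    have step2 : 2 / θ * d₁ ≤ 2 / θ * (L₂ - θ * F t x + a) := mul_le_mul_of_nonneg_left hq₁ hθ'
    linarith [step1, step2, hθF, hKF, htb, hθa, hFx]
  -- (4) the weak maximum principle
  have hFc : ContDiffOn ℝ 1 (uncurry fun (_ _ : ℝ) ↦ τ * b + 2 * a / θ) (univ ×ˢ Icc 0 τ) :=
    contDiffOn_const
  set φ : ℝ → ℝ := fun s ↦ 2 / θ * A₀ + (τ * b + 2 * a / θ) * s with hφ
  have hφd : ∀ s ∈ Icc 0 τ,
      HasDerivWithinAt φ ((fun (_ _ : ℝ) ↦ τ * b + 2 * a / θ) (φ s) s) (Icc 0 τ) s := by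
    intro s _
    show HasDerivWithinAt φ (τ * b + 2 * a / θ) (Icc 0 τ) s
    have h : HasDerivAt φ (τ * b + 2 * a / θ) s := by
      have h1 := ((hasDerivAt_id s).const_mul (τ * b + 2 * a / θ)).const_add (2 / θ * A₀)
      simpa [hφ] using h1
    exact h.hasDerivWithinAt
  have hφ0 : φ 0 = 2 / θ * A₀ := by simp [hφ]
  have hu0 : ∀ x : M, u 0 x ≤ 2 / θ * A₀ := by
    intro x
    show 0 * F 0 x + 2 / θ * f 0 x ≤ 2 / θ * A₀
    rw [zero_mul, zero_add]
    exact mul_le_mul_of_nonneg_left (h0 x) hθ'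
  have hmp := weakMaximumPrinciple hτ hgR (fun (_ : ℝ) (_ : M) ↦ (0 : E)) hFc husmooth hineq
    hφd hφ0 hu0
  -- (5) extraction
  intro t ht x
  have hut : t * F t x ≤ u t x := le_add_of_nonneg_right (mul_nonneg hθ' (hfnn t ht x))
  have hφt : φ t ≤ 2 / θ * A₀ + τ * (τ * b + 2 * a / θ) := by
    show 2 / θ * A₀ + (τ * b + 2 * a / θ) * t ≤ 2 / θ * A₀ + τ * (τ * b + 2 * a / θ)
    have h : (τ * b + 2 * a / θ) * t ≤ (τ * b + 2 * a / θ) * τ :=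
      mul_le_mul_of_nonneg_left ht.2 hDnn
    linarith [h]
  exact hut.trans ((hmp t ht x).trans hφt)

end Core

/-- **The Bernstein–Shi window lemma** (layer S3w of `stub_smoothRoundLimit`; the abstract
maximum-principle step of Hamilton 1982, §13 / Shi 1989, §7 / Topping 2006, Thm. 3.3.1): on a
closed 4-manifold with Riemannian metrics `g t`, `t ∈ [0, T)`, let `f, F ≥ 0` be jointly `C^∞` on
`M × [0, T)` with `∂ₜ f ≤ Δ f − θ F + Φ_f`, `∂ₜ F ≤ Δ F + Φ_F` (`∂ₜ` within `[0, T)`, `θ > 0`).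
On a window `[t₁, t₁ + τ] ⊂ [0, T)` with `Φ_f ≤ a`, `Φ_F ≤ K F + b`, `K τ ≤ 1`, `f(t₁, ·) ≤ A₀`
(`K, a, b ≥ 0`): `(t − t₁) F(t, x) ≤ (2/θ) A₀ + τ (τ b + 2a/θ)` for `t ∈ [t₁, t₁ + τ]`. Proof:
`bernsteinWindow_core` for the restarted data `s ↦ g(s + t₁), f(s + t₁, ·), F(s + t₁, ·)` on
`[0, τ]` (time derivatives within `[0, τ]` of the translates agree with those within `[0, T)`,
`hasDerivWithinAt_time_of`). [cite: Hamilton1982, §13] [cite: Topping2006, Thm. 3.1.1] -/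
theorem helper_bernsteinWindow : ∀ (M : Type) [TopologicalSpace M] [T2Space M] [SecondCountableTopology M] [ChartedSpace (EuclideanSpace ℝ (Fin 4)) M] [IsManifold (𝓡 4) ∞ M] [CompactSpace M] (g : ℝ → PseudoRiemannianMetric (𝓡 4) ∞ (EuclideanSpace ℝ (Fin 4)) (TangentSpace (𝓡 4) : M → Type _)) (T θ : ℝ) (f F Φf ΦF : ℝ → M → ℝ), 0 < T → 0 < θ → (∀ t ∈ Ico 0 T, (g t).IsRiemannian) → ContMDiffOn ((𝓡 4).prod 𝓘(ℝ, ℝ)) 𝓘(ℝ, ℝ) ∞ (fun p : M × ℝ ↦ f p.2 p.1) (univ ×ˢ Ico 0 T) → ContMDiffOn ((𝓡 4).prod 𝓘(ℝ, ℝ)) 𝓘(ℝ, ℝ) ∞ (fun p : M × ℝ ↦ F p.2 p.1) (univ ×ˢ Ico 0 T) → (∀ t ∈ Ico 0 T, ∀ x : M, 0 ≤ f t x) → (∀ t ∈ Ico 0 T, ∀ x : M, 0 ≤ F t x) → (∀ t ∈ Ico 0 T, ∀ x : M, derivWithin (fun s ↦ f s x) (Ico 0 T) t ≤ (g t).laplaceBeltrami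 (f t) x - θ * F t x + Φf t x) → (∀ t ∈ Ico 0 T, ∀ x : M, derivWithin (fun s ↦ F s x) (Ico 0 T) t ≤ (g t).laplaceBeltrami (F t) x + ΦF t x) → ∀ (t₁ τ K a b A₀ : ℝ), t₁ ∈ Ico 0 T → 0 < τ → t₁ + τ < T → 0 ≤ K → 0 ≤ a → 0 ≤ b → K * τ ≤ 1 → (∀ x : M, f t₁ x ≤ A₀) → (∀ t ∈ Icc t₁ (t₁ + τ), ∀ x : M, Φf t x ≤ a) → (∀ t ∈ Icc t₁ (t₁ + τ), ∀ x : M, ΦF t x ≤ K * F t x + b) → ∀ t ∈ Icc t₁ (t₁ + τ), ∀ x : M, (t - t₁) * F t x ≤ 2 / θ * A₀ + τ * (τ * b + 2 * a / θ) := by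
  intro M _ _ _ _ _ _ g T θ f F Φf ΦF hT hθ hgR hf hF hfnn hFnn hevf hevF t₁ τ K a b A₀ ht₁ hτ
    ht₁τ hK ha hb hKτ hA₀ hΦf hΦF
  -- the window `[t₁, t₁ + τ]` translated to `[0, τ]`
  have hmem : ∀ s ∈ Icc 0 τ, s + t₁ ∈ Ico 0 T := fun s hs ↦
    ⟨by linarith [hs.1, ht₁.1], by linarith [hs.2]⟩
  have hmem' : ∀ s ∈ Icc 0 τ, s + t₁ ∈ Icc t₁ (t₁ + τ) := fun s hs ↦
    ⟨by linarith [hs.1], by linarith [hs.2]⟩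
  have hmaps : MapsTo (fun s : ℝ ↦ s + t₁) (Icc 0 τ) (Ico 0 T) := fun s hs ↦ hmem s hs
  -- joint smoothness of the translates
  have htr : ∀ {u : ℝ → M → ℝ},
      ContMDiffOn ((𝓡 4).prod 𝓘(ℝ, ℝ)) 𝓘(ℝ, ℝ) ∞ (fun p : M × ℝ ↦ u p.2 p.1) (univ ×ˢ Ico 0 T) →
      ContMDiffOn ((𝓡 4).prod 𝓘(ℝ, ℝ)) 𝓘(ℝ, ℝ) ∞ (fun p : M × ℝ ↦ u (p.2 + t₁) p.1)
        (univ ×ˢ Icc 0 τ) := by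
    intro u hu
    have hφ : ContMDiff ((𝓡 4).prod 𝓘(ℝ, ℝ)) ((𝓡 4).prod 𝓘(ℝ, ℝ)) ∞
        (fun p : M × ℝ ↦ (p.1, p.2 + t₁)) :=
      contMDiff_fst.prodMk (contMDiff_snd.add contMDiff_const)
    refine hu.comp hφ.contMDiffOn ?_
    rintro ⟨x, s⟩ ⟨-, hs⟩
    exact ⟨mem_univ _, hmem s hs⟩
  -- time derivatives of the translates within `[0, τ]`
  have hder : ∀ {u : ℝ → M → ℝ},
      ContMDiffOn ((𝓡 4).prod 𝓘(ℝ, ℝ)) 𝓘(ℝ, ℝ) ∞ (fun p : M × ℝ ↦ u p.2 p.1) (univ ×ˢ Ico 0 T) →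
      ∀ s ∈ Icc 0 τ, ∀ x : M, derivWithin (fun r ↦ u (r + t₁) x) (Icc 0 τ) s =
        derivWithin (fun r ↦ u r x) (Ico 0 T) (s + t₁) := by
    intro u hu s hs x
    have h1 : HasDerivWithinAt (fun r ↦ u r x) (derivWithin (fun r ↦ u r x) (Ico 0 T) (s + t₁))
        (Ico 0 T) (s + t₁) := hasDerivWithinAt_time_of hu x (hmem s hs)
    have h2 : HasDerivWithinAt (fun r : ℝ ↦ r + t₁) 1 (Icc 0 τ) s :=
      (hasDerivWithinAt_id s _).add_const t₁
    have h3 := h1.comp s h2 hmaps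
    rw [mul_one] at h3
    exact h3.derivWithin (uniqueDiffOn_Icc hτ s hs)
  -- the core lemma for the restarted data
  have hcore := bernsteinWindow_core (I := 𝓡 4) (g := fun s ↦ g (s + t₁))
    (f := fun s x ↦ f (s + t₁) x) (F := fun s x ↦ F (s + t₁) x) hτ hθ
    (fun s hs ↦ hgR _ (hmem s hs)) (htr hf) (htr hF)
    (fun s hs x ↦ hfnn _ (hmem s hs) x) (fun s hs x ↦ hFnn _ (hmem s hs) x) hK ha hb hKτ
    (fun x ↦ by simpa using hA₀ x)
    (fun s hs x ↦ by
      beta_reduce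
      rw [hder hf s hs x]
      have h₁ := hevf _ (hmem s hs) x
      have h₂ := hΦf _ (hmem' s hs) x
      linarith)
    (fun s hs x ↦ by
      beta_reduce
      rw [hder hF s hs x]
      have h₁ := hevF _ (hmem s hs) x
      have h₂ := hΦF _ (hmem' s hs) x
      linarith)
  intro t ht x
  have hs : t - t₁ ∈ Icc 0 τ := ⟨by linarith [ht.1], by linarith [ht.2]⟩
  have h := hcore (t - t₁) hs x
  simp only [sub_add_cancel] at h
  exact h

end Literature.Geometry.Riemannian.HamiltonPinchedFlow

end Part2

/-!
## Part 3 — port of `Summits/SmoothPoincare4/SmoothPoincare4/Theorems/EntropyRungChangGurskyYangStubSmoothRoundLimitDecayOneAux.lean` (5 declarations kept)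

# Decay of `|∇Rm|²` for a roundening Type-I Ricci flow — the maximum-principle bookkeeping (Hamilton 1982, §17, Thm. 17.6)

Declarations of this Part (verbatim port; each keeps its own docstring and citation): `roundDefect_eq`, `roundDefect_nonneg`, `roundDefect_le`, `roundDefect_reaction_le`, `helper_curvDeriv_decayWindow`.

References: R. S. Hamilton, *Three-manifolds with positive Ricci curvature*, J. Differential Geom. 17 (1982) 255–306 [Hamilton1982]; P. Topping, *Lectures on the Ricci flow*, LMS Lecture Note Series 325, CUP 2006 [Topping2006].
-/

section Part3

open _root_.Set

namespace Literature.Geometry.Riemannian.HamiltonPinchedFlow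

/-! ### Real-variable lemmas: the round defect and the reaction terms -/

section RealLemmas

/-- **The round defect is a sum of squares**: with `h ≠ 0`,
`|Rm|² − 2R/(3h) + 2/(3h²) = |W|² + 2|E|² + (hR − 2)²/(6h²)`, where `|W|² = |Rm|² − 2|Ric|² + R²/3`
and `|E|² = |Ric|² − R²/4` (Hamilton 1982, §17, proof of Thm. 17.6: the pinching quantity measuring
the distance from the round shrinking state `E = 0`, `W = 0`, `R = 2/(T − t)` in dimension 4).
[cite: Hamilton1982, §17, Thm. 17.6] -/
theorem roundDefect_eq {h R N Q : ℝ} (hh : h ≠ 0) :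
    Q - 2 * R / (3 * h) + 2 / (3 * h ^ 2) =
      (h ^ 2 * (Q - 2 * N + R ^ 2 / 3) + 2 * (h ^ 2 * (N - R ^ 2 / 4)) + (h * R - 2) ^ 2 / 6) /
        h ^ 2 := by
  field_simp
  ring

/-- **The round defect is nonnegative** (`|W|², |E|² ≥ 0`). [cite: Hamilton1982, §17, Thm. 17.6] -/
theorem roundDefect_nonneg {h R N Q : ℝ} (hh : 0 < h) (hE : 0 ≤ N - R ^ 2 / 4)
    (hW : 0 ≤ Q - 2 * N + R ^ 2 / 3) : 0 ≤ Q - 2 * R / (3 * h) + 2 / (3 * h ^ 2) := by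
  rw [roundDefect_eq (N := N) hh.ne']
  exact div_nonneg (add_nonneg (add_nonneg (mul_nonneg (sq_nonneg h) hW)
    (mul_nonneg zero_le_two (mul_nonneg (sq_nonneg h) hE))) (div_nonneg (sq_nonneg _) (by norm_num)))
    (sq_nonneg h)

/-- **Smallness of the round defect under the roundness rates** (Hamilton 1982, §17, Thm. 17.6,
step 1): if `|hR − 2| ≤ C u²`, `h²|E|² ≤ C u²`, `h²|W|² ≤ C u²` with `0 ≤ u ≤ 1`, `C ≥ 0`, then
`|Rm|² − 2R/(3h) + 2/(3h²) ≤ (3C + C²/6) u²/h²`. [cite: Hamilton1982, §17, Thm. 17.6] -/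
theorem roundDefect_le {h u R N Q C : ℝ} (hh : 0 < h) (hu0 : 0 ≤ u) (hu1 : u ≤ 1)
    (h1 : |h * R - 2| ≤ C * u ^ 2) (h2 : h ^ 2 * (N - R ^ 2 / 4) ≤ C * u ^ 2)
    (h3 : h ^ 2 * (Q - 2 * N + R ^ 2 / 3) ≤ C * u ^ 2) :
    Q - 2 * R / (3 * h) + 2 / (3 * h ^ 2) ≤ (3 * C + C ^ 2 / 6) * u ^ 2 / h ^ 2 := by
  rw [roundDefect_eq (N := N) hh.ne']
  refine div_le_div_of_nonneg_right ?_ (sq_nonneg h)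
  have hsq : (h * R - 2) ^ 2 ≤ (C * u ^ 2) ^ 2 := by
    calc (h * R - 2) ^ 2 = |h * R - 2| ^ 2 := (sq_abs _).symm
      _ ≤ (C * u ^ 2) ^ 2 := pow_le_pow_left₀ (abs_nonneg _) h1 2
  have hu2 : u ^ 2 ≤ 1 := pow_le_one₀ hu0 hu1
  have hC2 : (C * u ^ 2) ^ 2 ≤ C ^ 2 * u ^ 2 := by
    have : (C * u ^ 2) ^ 2 = C ^ 2 * u ^ 2 * u ^ 2 := by ring
    rw [this]
    exact mul_le_of_le_one_right (by positivity) hu2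
  nlinarith [h2, h3, hsq, hC2]

/-- **The reaction terms of the round defect are integrable in scale** (Hamilton 1982, §17,
Thm. 17.6, step 2): with `0 ≤ P ≤ C_P u²/h²`, `0 ≤ Q ≤ C_Q/h²`, `0 ≤ u ≤ 1`,
`C₂ (Q + h⁻²) √|P| + C₂ √Q |P| ≤ C_a u/h³`, `C_a = C₂(C_Q + 1)√C_P + C₂ √C_Q C_P`.
[cite: Hamilton1982, §17, Thm. 17.6] -/
theorem roundDefect_reaction_le {h u P Q C₂ CP CQ : ℝ} (hh : 0 < h) (hu0 : 0 ≤ u) (hu1 : u ≤ 1)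
    (hC₂ : 0 ≤ C₂) (hCP : 0 ≤ CP) (hCQ : 0 ≤ CQ) (hP0 : 0 ≤ P) (hP : P ≤ CP * u ^ 2 / h ^ 2)
    (hQ : Q ≤ CQ * (h ^ 2)⁻¹) :
    C₂ * (Q + (h ^ 2)⁻¹) * √|P| + C₂ * √Q * |P| ≤
      (C₂ * (CQ + 1) * √CP + C₂ * √CQ * CP) * u / h ^ 3 := by
  have hh0 : h ≠ 0 := hh.ne'
  rw [abs_of_nonneg hP0]
  have hsP : √P ≤ √CP * u / h := by
    rw [Real.sqrt_le_left (by positivity)]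
    calc P ≤ CP * u ^ 2 / h ^ 2 := hP
      _ = (√CP * u / h) ^ 2 := by rw [div_pow, mul_pow, Real.sq_sqrt hCP]
  have hsQ : √Q ≤ √CQ / h := by
    rw [Real.sqrt_le_left (by positivity)]
    calc Q ≤ CQ * (h ^ 2)⁻¹ := hQ
      _ = (√CQ / h) ^ 2 := by rw [div_pow, Real.sq_sqrt hCQ, div_eq_mul_inv]
  have hQ' : Q ≤ CQ / h ^ 2 := by rwa [div_eq_mul_inv]
  have hQ1 : Q + (h ^ 2)⁻¹ ≤ (CQ + 1) / h ^ 2 := by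
    rw [add_div, one_div]
    exact add_le_add hQ' le_rfl
  have hPu : P ≤ CP * u / h ^ 2 := by
    refine hP.trans (div_le_div_of_nonneg_right ?_ (sq_nonneg h))
    nlinarith [mul_le_mul_of_nonneg_left hu1 (mul_nonneg hCP hu0)]
  have t1 : C₂ * (Q + (h ^ 2)⁻¹) * √P ≤ C₂ * ((CQ + 1) / h ^ 2) * (√CP * u / h) :=
    mul_le_mul (mul_le_mul_of_nonneg_left hQ1 hC₂) hsP (Real.sqrt_nonneg _) (by positivity)
  have t2 : C₂ * √Q * P ≤ C₂ * (√CQ / h) * (CP * u / h ^ 2) :=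
    mul_le_mul (mul_le_mul_of_nonneg_left hsQ hC₂) hPu hP0 (by positivity)
  calc C₂ * (Q + (h ^ 2)⁻¹) * √P + C₂ * √Q * P
        ≤ C₂ * ((CQ + 1) / h ^ 2) * (√CP * u / h) + C₂ * (√CQ / h) * (CP * u / h ^ 2) :=
      add_le_add t1 t2
    _ = (C₂ * (CQ + 1) * √CP + C₂ * √CQ * CP) * u / h ^ 3 := by
      field_simp

end RealLemmas

/-! ### The maximum-principle endgame (abstract form) -/

section Endgame

/-- **Hamilton 1982, §17, Thm. 17.6 for `k = 1`, maximum-principle form — the endgame.** Abstract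
bookkeeping behind `helper_curvDeriv_decay_one` (`helper_curvDeriv_decayWindow`): `R, N, Q` (scalar curvature, `|Ric|²`, `|Rm|²`),
the round defect `P = Q − 2R/(3h) + 2/(3h²)` (`h = T − t`), `F₁ = |∇Rm|²` and the two reaction
terms `Φf, ΦF` are arbitrary real functions on `[0, T) × α` subject to: the roundness rates on
`[t₀, T)`, `|E|², |W|² ≥ 0`, the curvature scale `Q ≤ C_Q h⁻²` on `[t_Q, T)`, `F₁ ≥ 0`,
`Φf ≤ C₂(Q + h⁻²)√|P| + C₂√Q|P|`, `ΦF ≤ 3C_s√Q F₁`, and the Bernstein window lemma for the pair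
`(P, F₁)` with `θ = 2`. Then `F₁ ≤ C₁ h^{δ₁−3}` on some `[t₁, T)` with `δ₁ = min δ 1 / 2 > 0`.
Proof: on `[s₀, T)`, `s₀ = max t₀ t_Q (T−1)`, one has `P ≤ C_P u²/h²` and `Φf ≤ C_a u/h³`
(`u = h^{δ₁} ≤ 1`; `roundDefect_le`, `roundDefect_reaction_le`); on the window
`[t₁, t₁ + κh₁]`, `h₁ = T − t₁`, `κ = min ½ (1/(6C_s√C_Q + 1))`, the window lemma with
`A₀ = C_P u₁²/h₁²`, `a = 8C_a u₁/h₁³`, `K = 6C_s√C_Q/h₁`, `b = 0` gives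
`κh₁³ F₁(t₁ + κh₁) ≤ (C_P + 8C_a) u₁`; every `t ≥ s₀ + κ(T − s₀)` is `t₁ + κh₁` with
`h ≤ h₁ ≤ 2h`. [cite: Hamilton1982, §17, Thm. 17.6] [cite: Topping2006, Thm. 3.3.1] -/
theorem helper_curvDeriv_decayWindow : ∀ (α : Type) (T δ C t₀ tQ CQ C₂ Cs : ℝ) (R N Q P F₁ Φf ΦF : ℝ → α → ℝ), 0 < δ → t₀ ∈ Ico 0 T → tQ ∈ Ico 0 T → 0 ≤ C₂ → 0 ≤ Cs → (∀ t ∈ Ico t₀ T, ∀ x : α, |(T - t) * R t x - 2| ≤ C * (T - t) ^ δ ∧ (T - t) ^ 2 * (N t x - R t x ^ 2 / 4) ≤ C * (T - t) ^ (2 * δ) ∧ (T - t) ^ 2 * (Q t x - 2 * N t x + R t x ^ 2 / 3) ≤ C * (T - t) ^ δ) → (∀ t ∈ Ico tQ T, ∀ x : α, Q t x ≤ CQ * ((T - t) ^ 2)⁻¹) → (∀ (t : ℝ) (x : α), P t x = Q t x - 2 * R t x / (3 * (T - t)) + 2 / (3 * (T - t) ^ 2)) → (∀ t ∈ Ico 0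 T, ∀ x : α, 0 ≤ P t x) → (∀ t ∈ Ico 0 T, ∀ x : α, 0 ≤ F₁ t x) → (∀ t ∈ Ico 0 T, ∀ x : α, Φf t x ≤ C₂ * (Q t x + ((T - t) ^ 2)⁻¹) * Real.sqrt |P t x| + C₂ * Real.sqrt (Q t x) * |P t x|) → (∀ t ∈ Ico 0 T, ∀ x : α, ΦF t x ≤ 3 * Cs * Real.sqrt (Q t x) * F₁ t x) → (∀ (t₁ τ K a b A₀ : ℝ), t₁ ∈ Ico 0 T → 0 < τ → t₁ + τ < T → 0 ≤ K → 0 ≤ a → 0 ≤ b → K * τ ≤ 1 → (∀ x : α, P t₁ x ≤ A₀) → (∀ t ∈ Icc t₁ (t₁ + τ), ∀ x : α, Φf t x ≤ a) → (∀ t ∈ Icc t₁ (t₁ + τ), ∀ x : α, ΦF t x ≤ K * F₁ t x + b) → ∀ t ∈ Icc t₁ (t₁ + τ), ∀ x : α, (t - t₁) * F₁ t x ≤ 2 / 2 * A₀ + τ * (τ * b + 2 * a / 2)) → ∃ δ₁ C₁ t₁ : ℝ, 0 < δ₁ ∧ t₁ ∈ Ico 0 T ∧ ∀ t ∈ Ico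 t₁ T, ∀ x : α, F₁ t x ≤ C₁ * (T - t) ^ (δ₁ - 3) := by
  intro α T δ C t₀ tQ CQ C₂ Cs R N Q P F₁ Φf ΦF hδ ht₀ htQ hC₂ hCs hrate hQ hPdef hP0 hF₁ hΦf hΦF hwin
  -- the exponent `e = δ₁` and the constants
  set e : ℝ := min δ 1 / 2 with he_def
  have hmin : 0 < min δ 1 := lt_min hδ one_pos
  have he0 : 0 < e := by positivity
  have he1 : e ≤ 1 / 2 := by have := min_le_right δ 1; linarith
  have h2e : 2 * e ≤ δ := by have := min_le_left δ 1; linarith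
  set C' : ℝ := max C 0 with hC'_def
  have hC'0 : 0 ≤ C' := le_max_right _ _
  have hCC' : C ≤ C' := le_max_left _ _
  set CQ' : ℝ := max CQ 0 with hCQ'_def
  have hCQ'0 : 0 ≤ CQ' := le_max_right _ _
  set CP : ℝ := 3 * C' + C' ^ 2 / 6 with hCP_def
  have hCP0 : 0 ≤ CP := by positivity
  set Ca : ℝ := C₂ * (CQ' + 1) * √CP + C₂ * √CQ' * CP with hCa_def
  have hCa0 : 0 ≤ Ca := by positivity
  set L : ℝ := 6 * Cs * √CQ' with hL_def
  have hL0 : 0 ≤ L := by positivity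
  set κ : ℝ := min (1 / 2) (1 / (L + 1)) with hκ_def
  have hκ0 : 0 < κ := lt_min (by norm_num) (by positivity)
  have hκ2 : κ ≤ 1 / 2 := min_le_left _ _
  have hκL : L * κ ≤ 1 := by
    have h1 : κ ≤ 1 / (L + 1) := min_le_right _ _
    have h2 : L * κ ≤ L * (1 / (L + 1)) := mul_le_mul_of_nonneg_left h1 hL0
    have h3 : L * (1 / (L + 1)) ≤ 1 := by
      rw [mul_one_div, div_le_one (by positivity)]
      linarith
    exact h2.trans h3
  -- the late initial time `s₀`
  set s₀ : ℝ := max (max t₀ tQ) (T - 1) with hs₀_def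
  have hs₀0 : 0 ≤ s₀ := ht₀.1.trans ((le_max_left _ _).trans (le_max_left _ _))
  have hs₀T : s₀ < T := max_lt (max_lt ht₀.2 htQ.2) (by linarith)
  have hmem : ∀ t ∈ Ico s₀ T, t ∈ Ico 0 T ∧ t ∈ Ico t₀ T ∧ t ∈ Ico tQ T ∧ 0 < T - t ∧ T - t ≤ 1 := by
    intro t ht
    have h1 : t₀ ≤ t := ((le_max_left _ _).trans (le_max_left _ _)).trans ht.1
    have h2 : tQ ≤ t := ((le_max_right _ _).trans (le_max_left _ _)).trans ht.1
    have h3 : T - 1 ≤ t := (le_max_right _ _).trans ht.1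
    exact ⟨⟨ht₀.1.trans h1, ht.2⟩, ⟨h1, ht.2⟩, ⟨h2, ht.2⟩, sub_pos.2 ht.2, by linarith⟩
  -- conversion of the rates: `h^γ ≤ (h^e)²` for `γ ≥ 2e`, `0 < h ≤ 1`
  have hconv : ∀ {h γ : ℝ}, 0 < h → h ≤ 1 → 2 * e ≤ γ → h ^ γ ≤ (h ^ e) ^ 2 := by
    intro h γ hh hh1 hγ
    have : (h ^ e) ^ 2 = h ^ (2 * e) := by
      rw [mul_comm, Real.rpow_mul hh.le, Real.rpow_two]
    rw [this]
    exact Real.rpow_le_rpow_of_exponent_ge hh hh1 hγ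
  -- the round defect is small on `[s₀, T)`
  have hPbd : ∀ t ∈ Ico s₀ T, ∀ x, P t x ≤ CP * ((T - t) ^ e) ^ 2 / (T - t) ^ 2 := by
    intro t ht x
    obtain ⟨-, htt₀, -, hh, hh1⟩ := hmem t ht
    obtain ⟨r1, r2, r3⟩ := hrate t htt₀ x
    have hu : 0 ≤ (T - t) ^ e := Real.rpow_nonneg hh.le e
    have hu1 : (T - t) ^ e ≤ 1 := Real.rpow_le_one hh.le hh1 he0.le
    have c1 : C * (T - t) ^ δ ≤ C' * ((T - t) ^ e) ^ 2 :=
      (mul_le_mul_of_nonneg_right hCC' (Real.rpow_nonneg hh.le δ)).trans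
        (mul_le_mul_of_nonneg_left (hconv hh hh1 h2e) hC'0)
    have c2 : C * (T - t) ^ (2 * δ) ≤ C' * ((T - t) ^ e) ^ 2 :=
      (mul_le_mul_of_nonneg_right hCC' (Real.rpow_nonneg hh.le _)).trans
        (mul_le_mul_of_nonneg_left (hconv hh hh1 (by linarith)) hC'0)
    rw [hPdef]
    exact roundDefect_le hh hu hu1 (r1.trans c1) (r2.trans c2) (r3.trans c1)
  -- the curvature scale on `[s₀, T)`
  have hQbd : ∀ t ∈ Ico s₀ T, ∀ x, Q t x ≤ CQ' * ((T - t) ^ 2)⁻¹ := by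
    intro t ht x
    obtain ⟨-, -, httQ, -, -⟩ := hmem t ht
    exact (hQ t httQ x).trans
      (mul_le_mul_of_nonneg_right (le_max_left _ _) (inv_nonneg.2 (sq_nonneg _)))
  -- the reaction term of `P` on `[s₀, T)`
  have hΦfbd : ∀ t ∈ Ico s₀ T, ∀ x, Φf t x ≤ Ca * (T - t) ^ e / (T - t) ^ 3 := by
    intro t ht x
    obtain ⟨htT, -, -, hh, hh1⟩ := hmem t ht
    exact (hΦf t htT x).trans (roundDefect_reaction_le hh (Real.rpow_nonneg hh.le e)
      (Real.rpow_le_one hh.le hh1 he0.le) hC₂ hCP0 hCQ'0 (hP0 t htT x) (hPbd t ht x) (hQbd t ht x))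
  -- the reaction term of `F₁` on `[s₀, T)`
  have hΦFbd : ∀ t ∈ Ico s₀ T, ∀ x, ΦF t x ≤ 3 * Cs * √CQ' / (T - t) * F₁ t x := by
    intro t ht x
    obtain ⟨htT, -, -, hh, -⟩ := hmem t ht
    have hsq : √(Q t x) ≤ √CQ' / (T - t) := by
      rw [Real.sqrt_le_left (by positivity)]
      calc Q t x ≤ CQ' * ((T - t) ^ 2)⁻¹ := hQbd t ht x
        _ = (√CQ' / (T - t)) ^ 2 := by rw [div_pow, Real.sq_sqrt hCQ'0, div_eq_mul_inv]
    calc ΦF t x ≤ 3 * Cs * √(Q t x) * F₁ t x := hΦF t htT x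
      _ ≤ 3 * Cs * (√CQ' / (T - t)) * F₁ t x :=
        mul_le_mul_of_nonneg_right (mul_le_mul_of_nonneg_left hsq (by positivity)) (hF₁ t htT x)
      _ = 3 * Cs * √CQ' / (T - t) * F₁ t x := by ring
  -- the window step: `κ h₁³ F₁(t₁ + κ h₁) ≤ (C_P + 8 C_a) u₁`
  have hclaim : ∀ t₁ ∈ Ico s₀ T, ∀ x,
      κ * (T - t₁) ^ 3 * F₁ (t₁ + κ * (T - t₁)) x ≤ (CP + 8 * Ca) * (T - t₁) ^ e := by
    intro t₁ ht₁ x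
    obtain ⟨ht₁T, -, -, hh₁, hh₁1⟩ := hmem t₁ ht₁
    have hu₁0 : 0 ≤ (T - t₁) ^ e := Real.rpow_nonneg hh₁.le e
    have hu₁1 : (T - t₁) ^ e ≤ 1 := Real.rpow_le_one hh₁.le hh₁1 he0.le
    have hτ0 : 0 < κ * (T - t₁) := mul_pos hκ0 hh₁
    have hτT : t₁ + κ * (T - t₁) < T := by
      have : κ * (T - t₁) < 1 * (T - t₁) := mul_lt_mul_of_pos_right (by linarith) hh₁
      linarith
    have hK0 : 0 ≤ L / (T - t₁) := div_nonneg hL0 hh₁.le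
    have hKτ : L / (T - t₁) * (κ * (T - t₁)) ≤ 1 := by
      rw [show L / (T - t₁) * (κ * (T - t₁)) = L * κ by field_simp]
      exact hκL
    have ha0 : 0 ≤ 8 * Ca * (T - t₁) ^ e / (T - t₁) ^ 3 := by positivity
    have hA₀ : ∀ x, P t₁ x ≤ CP * ((T - t₁) ^ e) ^ 2 / (T - t₁) ^ 2 := fun x ↦ hPbd t₁ ht₁ x
    have hwmem : ∀ t ∈ Icc t₁ (t₁ + κ * (T - t₁)),
        t ∈ Ico s₀ T ∧ (T - t₁) / 2 ≤ T - t ∧ T - t ≤ T - t₁ := by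
      intro t ht
      refine ⟨⟨ht₁.1.trans ht.1, ht.2.trans_lt hτT⟩, ?_, by linarith [ht.1]⟩
      have := mul_le_mul_of_nonneg_right hκ2 hh₁.le
      linarith [ht.2]
    have ha : ∀ t ∈ Icc t₁ (t₁ + κ * (T - t₁)), ∀ x,
        Φf t x ≤ 8 * Ca * (T - t₁) ^ e / (T - t₁) ^ 3 := by
      intro t ht x
      obtain ⟨hts₀, hlow, hup⟩ := hwmem t ht
      have hh : 0 < T - t := by linarith
      refine (hΦfbd t hts₀ x).trans ?_
      rw [div_le_div_iff₀ (pow_pos hh 3) (pow_pos hh₁ 3)]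
      have hue : (T - t) ^ e ≤ (T - t₁) ^ e := Real.rpow_le_rpow hh.le hup he0.le
      have hcube : (T - t₁) ^ 3 ≤ 8 * (T - t) ^ 3 := by
        have h2 : T - t₁ ≤ 2 * (T - t) := by linarith
        calc (T - t₁) ^ 3 ≤ (2 * (T - t)) ^ 3 := pow_le_pow_left₀ hh₁.le h2 3
          _ = 8 * (T - t) ^ 3 := by ring
      calc Ca * (T - t) ^ e * (T - t₁) ^ 3 ≤ Ca * (T - t₁) ^ e * (8 * (T - t) ^ 3) :=
            mul_le_mul (mul_le_mul_of_nonneg_left hue hCa0) hcube (pow_nonneg hh₁.le 3)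
              (mul_nonneg hCa0 hu₁0)
        _ = 8 * Ca * (T - t₁) ^ e * (T - t) ^ 3 := by ring
    have hb : ∀ t ∈ Icc t₁ (t₁ + κ * (T - t₁)), ∀ x, ΦF t x ≤ L / (T - t₁) * F₁ t x + 0 := by
      intro t ht x
      obtain ⟨hts₀, hlow, -⟩ := hwmem t ht
      have hh : 0 < T - t := by linarith
      have hF0 := hF₁ t (hmem t hts₀).1 x
      rw [add_zero]
      refine (hΦFbd t hts₀ x).trans (mul_le_mul_of_nonneg_right ?_ hF0)
      rw [div_le_div_iff₀ hh hh₁, hL_def]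
      have h3 : 0 ≤ 3 * Cs * √CQ' := by positivity
      have := mul_le_mul_of_nonneg_left hlow h3
      linarith
    -- the window lemma at `t = t₁ + κ h₁`
    have hw := hwin t₁ (κ * (T - t₁)) (L / (T - t₁)) (8 * Ca * (T - t₁) ^ e / (T - t₁) ^ 3) 0
      (CP * ((T - t₁) ^ e) ^ 2 / (T - t₁) ^ 2) ht₁T hτ0 hτT hK0 ha0 le_rfl hKτ hA₀ ha hb
      (t₁ + κ * (T - t₁)) ⟨by linarith, le_rfl⟩ x
    have e1 : (t₁ + κ * (T - t₁) - t₁) * F₁ (t₁ + κ * (T - t₁)) x =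
        κ * (T - t₁) * F₁ (t₁ + κ * (T - t₁)) x := by ring
    have e2 : 2 / 2 * (CP * ((T - t₁) ^ e) ^ 2 / (T - t₁) ^ 2) + κ * (T - t₁) *
        (κ * (T - t₁) * 0 + 2 * (8 * Ca * (T - t₁) ^ e / (T - t₁) ^ 3) / 2) =
        (CP * ((T - t₁) ^ e) ^ 2 + 8 * κ * Ca * (T - t₁) ^ e) / (T - t₁) ^ 2 := by
      field_simp
      ring
    rw [e1, e2, le_div_iff₀ (pow_pos hh₁ 2)] at hw
    have hu₁sq : ((T - t₁) ^ e) ^ 2 ≤ (T - t₁) ^ e := pow_le_of_le_one hu₁0 hu₁1 two_ne_zero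
    have hq1 : CP * ((T - t₁) ^ e) ^ 2 ≤ CP * (T - t₁) ^ e := mul_le_mul_of_nonneg_left hu₁sq hCP0
    have hq2 : 8 * κ * Ca * (T - t₁) ^ e ≤ 8 * Ca * (T - t₁) ^ e := by
      have h8 : 0 ≤ 8 * Ca * (T - t₁) ^ e := by positivity
      have := mul_le_mul_of_nonneg_right (show κ ≤ 1 by linarith) h8
      linarith
    linarith only [hw, hq1, hq2]
  -- conclusion: every late time is the end of a window
  have hsT : 0 < T - s₀ := sub_pos.2 hs₀T
  have hs₁T : s₀ + κ * (T - s₀) < T := by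
    have : κ * (T - s₀) < 1 * (T - s₀) := mul_lt_mul_of_pos_right (by linarith) hsT
    linarith
  refine ⟨e, 2 * (CP + 8 * Ca) / κ, s₀ + κ * (T - s₀), he0,
    ⟨add_nonneg hs₀0 (mul_nonneg hκ0.le hsT.le), hs₁T⟩, fun t ht x ↦ ?_⟩
  have h1κ : 0 < 1 - κ := by linarith
  have hh : 0 < T - t := sub_pos.2 ht.2
  obtain ⟨t₁, ht₁_def⟩ : ∃ t₁ : ℝ, t₁ = (t - κ * T) / (1 - κ) := ⟨_, rfl⟩
  have ht₁t : t₁ + κ * (T - t₁) = t := by rw [ht₁_def]; field_simp; ring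
  have hTt₁ : T - t₁ = (T - t) / (1 - κ) := by rw [ht₁_def]; field_simp; ring
  have ht₁s₀ : s₀ ≤ t₁ := by
    rw [ht₁_def, le_div_iff₀ h1κ]
    linarith [ht.1]
  have ht₁T : t₁ < T := by
    rw [ht₁_def, div_lt_iff₀ h1κ]
    linarith [ht.2]
  have hc := hclaim t₁ ⟨ht₁s₀, ht₁T⟩ x
  rw [ht₁t] at hc
  have hh₁ : 0 < T - t₁ := sub_pos.2 ht₁T
  have hle : T - t ≤ T - t₁ := by
    rw [hTt₁, le_div_iff₀ h1κ]
    have := mul_nonneg hh.le hκ0.le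
    linarith
  have hle2 : T - t₁ ≤ 2 * (T - t) := by
    rw [hTt₁, div_le_iff₀ h1κ]
    have := mul_le_mul_of_nonneg_left (show 1 / 2 ≤ 1 - κ by linarith)
      (show (0 : ℝ) ≤ 2 * (T - t) by linarith)
    linarith
  have hF0 : 0 ≤ F₁ t x :=
    hF₁ t ⟨hs₀0.trans ((le_add_of_nonneg_right (mul_nonneg hκ0.le hsT.le)).trans ht.1), ht.2⟩ x
  have hu : 0 ≤ (T - t) ^ e := Real.rpow_nonneg hh.le e
  have hu₁ : (T - t₁) ^ e ≤ 2 * (T - t) ^ e := by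
    calc (T - t₁) ^ e ≤ (2 * (T - t)) ^ e := Real.rpow_le_rpow hh₁.le hle2 he0.le
      _ = 2 ^ e * (T - t) ^ e := Real.mul_rpow (by norm_num) hh.le
      _ ≤ 2 * (T - t) ^ e := by
        refine mul_le_mul_of_nonneg_right ?_ hu
        calc (2 : ℝ) ^ e ≤ 2 ^ (1 : ℝ) := Real.rpow_le_rpow_of_exponent_le (by norm_num) (by linarith)
          _ = 2 := Real.rpow_one 2
  have hcube : (T - t) ^ 3 ≤ (T - t₁) ^ 3 := pow_le_pow_left₀ hh.le hle 3
  have hmain : κ * (T - t) ^ 3 * F₁ t x ≤ 2 * (CP + 8 * Ca) * (T - t) ^ e := by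
    calc κ * (T - t) ^ 3 * F₁ t x ≤ κ * (T - t₁) ^ 3 * F₁ t x :=
          mul_le_mul_of_nonneg_right (mul_le_mul_of_nonneg_left hcube hκ0.le) hF0
      _ ≤ (CP + 8 * Ca) * (T - t₁) ^ e := hc
      _ ≤ (CP + 8 * Ca) * (2 * (T - t) ^ e) := mul_le_mul_of_nonneg_left hu₁ (by positivity)
      _ = 2 * (CP + 8 * Ca) * (T - t) ^ e := by ring
  rw [Real.rpow_sub hh, Real.rpow_ofNat, mul_div_assoc', le_div_iff₀ (pow_pos hh 3),
    div_mul_eq_mul_div, le_div_iff₀ hκ0]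
  linarith [hmain]

end Endgame

end Literature.Geometry.Riemannian.HamiltonPinchedFlow

end Part3

/-!
## Part 4 — port of `Summits/SmoothPoincare4/SmoothPoincare4/Theorems/EntropyRungChangGurskyYangStubSmoothRoundLimitDecayOne.lean` (4 declarations kept)

# Decay of `|∇Rm|²` for a roundening Type-I Ricci flow (Hamilton 1982, §17, Thm. 17.6, `k = 1`)

Declarations of this Part (verbatim port; each keeps its own docstring and citation): `traceless_weyl_nonneg`, `contMDiffOn_roundDefect`, `curvDeriv_one_reaction_le`, `helper_curvDeriv_decay_one`.

References: R. S. Hamilton, *Three-manifolds with positive Ricci curvature*, J. Differential Geom. 17 (1982) 255–306 [Hamilton1982]; P. Topping, *Lectures on the Ricci flow*, LMS Lecture Note Series 325, CUP 2006 [Topping2006]; A. L. Besse, *Einstein Manifolds*, Springer 1987 [Besse1987].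
-/

section Part4

open _root_.Set _root_.Function _root_.Filter
open scoped _root_.Manifold _root_.ContDiff _root_.Topology

namespace Literature.Geometry.Riemannian.HamiltonPinchedFlow

open Literature.Geometry.Riemannian
open Literature.Geometry.Lorentzian Literature.Geometry.Lorentzian.PseudoRiemannianMetric

/-! ### The pieces on the manifold -/

section FourDim

variable {M : Type*} [TopologicalSpace M] [ChartedSpace (EuclideanSpace ℝ (Fin 4)) M]
  [IsManifold (𝓡 4) ∞ M]
  {g : ℝ → PseudoRiemannianMetric (𝓡 4) ∞ (EuclideanSpace ℝ (Fin 4)) (TangentSpace (𝓡 4) : M → Type _)}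
  {cov : ℝ → CovariantDerivative (𝓡 4) (EuclideanSpace ℝ (Fin 4)) (TangentSpace (𝓡 4) : M → Type _)}
  {T : ℝ}

/-- **`|E|² ≥ 0` and `|W|² ≥ 0` along the flow, in the `cov t` quantities** (Besse 1987,
(1.116)–1.118; tree `tracelessRicciNormSq_eq_normSq`, `weylNormSq_eq_curvNormSqWith`, as in
`roundness_dictionary`): `0 ≤ |Ric|² − R²/4` and `0 ≤ |Rm|² − 2|Ric|² + R²/3` for a Riemannian
member of a Ricci flow on a 4-manifold. [cite: Hamilton1982, §17, Thm. 17.6]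
[cite: Besse1987, (1.116)–1.118] -/
theorem traceless_weyl_nonneg (hflow : IsRicciFlow g cov (Ico 0 T))
    (hRiem : ∀ t ∈ Ico 0 T, (g t).IsRiemannian) {t : ℝ} (ht : t ∈ Ico 0 T) (x : M) :
    0 ≤ (g t).normSq x ((cov t).ricci x) - (g t).scalarCurvatureWith (cov t) x ^ 2 / 4 ∧
    0 ≤ (g t).curvNormSqWith (cov t) x - 2 * (g t).normSq x ((cov t).ricci x) +
        (g t).scalarCurvatureWith (cov t) x ^ 2 / 3 := by
  haveI := (g t).hasLeviCivita
  have h2 : (2 : ℕ∞ω) ≤ ∞ := WithTop.coe_le_coe.mpr le_top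
  have hLC := hflow.isLeviCivita t ht
  have hric : (cov t).ricci x = (g t).ricci x := hLC.ricci_eq_ricci h2 x
  have hscal : (g t).scalarCurvatureWith (cov t) x = (g t).scalarCurvature x := by
    show (g t).trace x ((cov t).ricci x) = (g t).trace x ((g t).ricci x)
    rw [hric]
  have hcurv : (g t).curvNormSqWith (cov t) x = (g t).curvNormSqWith (g t).leviCivita x :=
    (g t).curvNormSqWith_congr (hLC.curvature_eq_riemann h2 x)
  have hE := (g t).tracelessRicciNormSq_eq_normSq (hRiem t ht) finrank_euclideanSpace_fin x
  have hW := (g t).weylNormSq_eq_curvNormSqWith (hRiem t ht) finrank_euclideanSpace_fin x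
  have hEnn := (g t).tracelessRicciNormSq_nonneg x
  have hWnn := (g t).weylNormSq_nonneg x
  rw [hric, hscal, hcurv]
  exact ⟨by rw [← hE]; exact hEnn, by rw [← hW]; exact hWnn⟩

/-- **The round defect `P = |Rm|² − 2R/(3(T−t)) + 2/(3(T−t)²)` is smooth on `M × [0, T)`** along a
Ricci flow of Riemannian metrics (`|Rm|² = U_0`, `IsRicciFlow.contMDiffOn_curvDerivNormSq`; `R`,
`IsContMDiffFamilyOn.contMDiffOn_scalarCurvatureWith`; Topping 2006, §1.2.3).
[cite: Topping2006, Thm. 3.3.1] [cite: Hamilton1982, §17, Thm. 17.6] -/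
theorem contMDiffOn_roundDefect (hflow : IsRicciFlow g cov (Ico 0 T)) (hT : 0 < T)
    (hRiem : ∀ t ∈ Ico 0 T, (g t).IsRiemannian) :
    ContMDiffOn ((𝓡 4).prod 𝓘(ℝ, ℝ)) 𝓘(ℝ, ℝ) ∞
      (fun p : M × ℝ ↦ (g p.2).curvNormSqWith (cov p.2) p.1 -
        2 * (g p.2).scalarCurvatureWith (cov p.2) p.1 / (3 * (T - p.2)) + 2 / (3 * (T - p.2) ^ 2))
      (univ ×ˢ Ico 0 T) := by
  have hS : UniqueDiffOn ℝ (Ico 0 T) := uniqueDiffOn_Ico 0 T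
  have hS' : Ico 0 T ⊆ closure (interior (Ico 0 T)) := Ico_subset_closure_interior hT
  have hQs : ContMDiffOn ((𝓡 4).prod 𝓘(ℝ, ℝ)) 𝓘(ℝ, ℝ) ∞
      (fun p : M × ℝ ↦ (g p.2).curvNormSqWith (cov p.2) p.1) (univ ×ˢ Ico 0 T) :=
    (hflow.contMDiffOn_curvDerivNormSq hS hS' hRiem 0).congr fun p hp ↦
      (curvDerivNormSq_zero_eq (hRiem p.2 hp.2) (hflow.isLeviCivita p.2 hp.2) p.1).symm
  have hRs : ContMDiffOn ((𝓡 4).prod 𝓘(ℝ, ℝ)) 𝓘(ℝ, ℝ) ∞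
      (fun p : M × ℝ ↦ (g p.2).scalarCurvatureWith (cov p.2) p.1) (univ ×ˢ Ico 0 T) :=
    hflow.smooth.contMDiffOn_scalarCurvatureWith hflow.isLeviCivita
  have hts : ContMDiffOn ((𝓡 4).prod 𝓘(ℝ, ℝ)) 𝓘(ℝ, ℝ) ∞ (fun p : M × ℝ ↦ T - p.2)
      (univ ×ˢ Ico 0 T) := (contMDiff_const.sub contMDiff_snd).contMDiffOn
  have hne : ∀ p : M × ℝ, p ∈ univ ×ˢ Ico (0 : ℝ) T → (3 * (T - p.2) : ℝ) ≠ 0 := fun p hp ↦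
    mul_ne_zero three_ne_zero (sub_pos.2 hp.2.2).ne'
  have hne2 : ∀ p : M × ℝ, p ∈ univ ×ˢ Ico (0 : ℝ) T → (3 * (T - p.2) ^ 2 : ℝ) ≠ 0 := fun p hp ↦
    mul_ne_zero three_ne_zero (pow_ne_zero 2 (sub_pos.2 hp.2.2).ne')
  have hi1 : ContMDiffOn ((𝓡 4).prod 𝓘(ℝ, ℝ)) 𝓘(ℝ, ℝ) ∞ (fun p : M × ℝ ↦ (3 * (T - p.2))⁻¹)
      (univ ×ˢ Ico 0 T) := (contMDiffOn_const.mul hts).inv₀ hne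
  have hi2 : ContMDiffOn ((𝓡 4).prod 𝓘(ℝ, ℝ)) 𝓘(ℝ, ℝ) ∞ (fun p : M × ℝ ↦ (3 * (T - p.2) ^ 2)⁻¹)
      (univ ×ˢ Ico 0 T) := (contMDiffOn_const.mul (hts.pow 2)).inv₀ hne2
  have h := (hQs.sub ((contMDiffOn_const (c := (2 : ℝ))).mul hRs |>.mul hi1)).add
    ((contMDiffOn_const (c := (2 : ℝ))).mul hi2)
  refine h.congr fun p _ ↦ ?_
  simp only [Pi.add_apply, Pi.mul_apply, div_eq_mul_inv, mul_assoc]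

/-- **The reaction term of the evolution inequality of `|∇Rm|²`** (Topping 2006, (3.3.4), `k = 1`):
`−2|∇²Rm|² + C(Σ_{p<2} √U_p √U_{1−p})√U_1 + C√U_0 U_1 ≤ 3C √|Rm|² |∇Rm|²`.
[cite: Topping2006, Thm. 3.3.1] [cite: Hamilton1982, §17, Thm. 17.6] -/
theorem curvDeriv_one_reaction_le (hflow : IsRicciFlow g cov (Ico 0 T))
    (hRiem : ∀ t ∈ Ico 0 T, (g t).IsRiemannian) {Cs : ℝ} {t : ℝ} (ht : t ∈ Ico 0 T) (x : M) :
    -2 * curvDerivNormSq (𝓡 4) g (1 + 1) t x +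
      Cs * (∑ p ∈ Finset.range (1 + 1), Real.sqrt (curvDerivNormSq (𝓡 4) g p t x) *
        Real.sqrt (curvDerivNormSq (𝓡 4) g (1 - p) t x)) * Real.sqrt (curvDerivNormSq (𝓡 4) g 1 t x) +
      Cs * Real.sqrt (curvDerivNormSq (𝓡 4) g 0 t x) * curvDerivNormSq (𝓡 4) g 1 t x ≤
    3 * Cs * Real.sqrt ((g t).curvNormSqWith (cov t) x) * curvDerivNormSq (𝓡 4) g 1 t x := by
  have hF2 : 0 ≤ curvDerivNormSq (𝓡 4) g (1 + 1) t x := curvDerivNormSq_nonneg (hRiem t ht) _ x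
  have hF1 : 0 ≤ curvDerivNormSq (𝓡 4) g 1 t x := curvDerivNormSq_nonneg (hRiem t ht) 1 x
  have hsum : ∑ p ∈ Finset.range (1 + 1), Real.sqrt (curvDerivNormSq (𝓡 4) g p t x) *
      Real.sqrt (curvDerivNormSq (𝓡 4) g (1 - p) t x) =
      2 * (Real.sqrt (curvDerivNormSq (𝓡 4) g 0 t x) * Real.sqrt (curvDerivNormSq (𝓡 4) g 1 t x)) := by
    simp only [Finset.sum_range_succ, Finset.sum_range_zero, Nat.sub_zero, Nat.sub_self, zero_add]
    ring
  have hsq : Real.sqrt (curvDerivNormSq (𝓡 4) g 1 t x) * Real.sqrt (curvDerivNormSq (𝓡 4) g 1 t x) =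
      curvDerivNormSq (𝓡 4) g 1 t x := Real.mul_self_sqrt hF1
  rw [hsum, curvDerivNormSq_zero_eq (hRiem t ht) (hflow.isLeviCivita t ht) x]
  have key : Cs * (2 * (Real.sqrt ((g t).curvNormSqWith (cov t) x) *
      Real.sqrt (curvDerivNormSq (𝓡 4) g 1 t x))) * Real.sqrt (curvDerivNormSq (𝓡 4) g 1 t x) +
      Cs * Real.sqrt ((g t).curvNormSqWith (cov t) x) * curvDerivNormSq (𝓡 4) g 1 t x =
      3 * Cs * Real.sqrt ((g t).curvNormSqWith (cov t) x) * curvDerivNormSq (𝓡 4) g 1 t x := by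
    linear_combination (2 * Cs * Real.sqrt ((g t).curvNormSqWith (cov t) x)) * hsq
  linarith [key, hF2]

end FourDim

/-- **HELPER S3b — DECAY OF `|∇Rm|²` FOR A ROUNDENING TYPE-I FLOW (Hamilton 1982, §17, Thm. 17.6,
`k = 1`, maximum-principle form; Topping 2006, Thm. 3.3.1).** Along a Ricci flow of Riemannian
metrics on `[0, T)`, `T > 0`, on a closed 4-manifold with the roundness rates
`|hR − 2| ≤ Ch^δ`, `h²|E|² ≤ Ch^{2δ}`, `h²|W|² ≤ Ch^δ` on `[t₀, T)` (`h = T − t`), the scaled Shi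
bounds `|∇ᵏRm|² ≤ C'h^{−k−2}` near `T`, the evolution inequality of the round defect
`P = |Rm|² − 2R/(3h) + 2/(3h²)` (hypothesis, neighbour `helper_roundDefect_evolution`) and the
Bernstein window lemma (hypothesis, neighbour `helper_bernsteinWindow`), there are `δ₁ > 0`, `C₁`
and `t₁ ∈ [0, T)` with `|∇Rm|² ≤ C₁ h^{δ₁−3}` on `M × [t₁, T)`. Proof: the window lemma is fed with
`θ = 2`, `f = P` (smooth on `M × [0, T)`, `contMDiffOn_roundDefect`; nonnegative,
`roundDefect_nonneg` with `traceless_weyl_nonneg`), `F = |∇Rm|²`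
(`IsRicciFlow.contMDiffOn_curvDerivNormSq`, `curvDerivNormSq_nonneg`), `Φf` the reaction term of
the hypothesis and `ΦF` that of `IsRicciFlow.derivWithin_curvDerivNormSq_le` (`k = 1`, bounded by
`3C√|Rm|² |∇Rm|²`, `curvDeriv_one_reaction_le`); the bookkeeping is
`helper_curvDeriv_decayWindow` of the Aux file (`δ₁ = min δ 1 / 2`). [cite: Hamilton1982, §17, Thm. 17.6]
[cite: Topping2006, Thm. 3.3.1] -/
theorem helper_curvDeriv_decay_one : ∀ (M : Type) [TopologicalSpace M] [T2Space M] [SecondCountableTopology M] [ChartedSpace (EuclideanSpace ℝ (Fin 4)) M] [IsManifold (𝓡 4) ∞ M] [CompactSpace M] (g : ℝ → PseudoRiemannianMetric (𝓡 4) ∞ (EuclideanSpace ℝ (Fin 4)) (TangentSpace (𝓡 4) : M → Type _)) (cov : ℝ → CovariantDerivative (𝓡 4) (EuclideanSpace ℝ (Fin 4)) (TangentSpace (𝓡 4) : M → Type _)) (T : ℝ), 0 < T → IsRicciFlow g cov (Ico 0 T) → (∀ t ∈ Ico 0 T, (g t).IsRiemannian) → ∀ (δ C t₀ : ℝ), 0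 < δ → t₀ ∈ Ico 0 T → (∀ t ∈ Ico t₀ T, ∀ x : M, |(T - t) * (g t).scalarCurvatureWith (cov t) x - 2| ≤ C * (T - t) ^ δ ∧ (T - t) ^ 2 * ((g t).normSq x ((cov t).ricci x) - (g t).scalarCurvatureWith (cov t) x ^ 2 / 4) ≤ C * (T - t) ^ (2 * δ) ∧ (T - t) ^ 2 * ((g t).curvNormSqWith (cov t) x - 2 * (g t).normSq x ((cov t).ricci x) + (g t).scalarCurvatureWith (cov t) x ^ 2 / 3) ≤ C * (T - t) ^ δ) → (∀ k : ℕ, ∃ C' t₁ : ℝ, t₁ ∈ Ico 0 T ∧ ∀ t ∈ Ico t₁ T, ∀ z : M, curvDerivNormSq (𝓡 4) g k t z ≤ C' * ((T - t) ^ (k + 2))⁻¹) → (∃ C₂ : ℝ, 0 ≤ C₂ ∧ ∀ t ∈ Ico 0 T, ∀ x : M, derivWithin (fun s ↦ ((g s).curvNormSqWith (cov s) x - 2 * (g s).scalarCurvatureWith (cov s) x / (3 * (T - s)) + 2 / (3 * (T - s) ^ 2))) (Ico 0 T) t ≤ (g t).laplaceBeltrami (fun y ↦ (g t).curvNormSqWith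 (cov t) y - 2 * (g t).scalarCurvatureWith (cov t) y / (3 * (T - t)) + 2 / (3 * (T - t) ^ 2)) x - 2 * curvDerivNormSq (𝓡 4) g 1 t x + C₂ * ((g t).curvNormSqWith (cov t) x + ((T - t) ^ 2)⁻¹) * Real.sqrt |((g t).curvNormSqWith (cov t) x - 2 * (g t).scalarCurvatureWith (cov t) x / (3 * (T - t)) + 2 / (3 * (T - t) ^ 2))| + C₂ * Real.sqrt ((g t).curvNormSqWith (cov t) x) * |((g t).curvNormSqWith (cov t) x - 2 * (g t).scalarCurvatureWith (cov t) x / (3 * (T - t)) + 2 / (3 * (T - t) ^ 2))|) → (∀ (θ : ℝ) (f F Φf ΦF : ℝ → M → ℝ), 0 < θ → ContMDiffOn ((𝓡 4).prod 𝓘(ℝ, ℝ)) 𝓘(ℝ, ℝ) ∞ (fun p : M × ℝ ↦ f p.2 p.1) (univ ×ˢ Ico 0 T) → ContMDiffOn ((𝓡 4).prod 𝓘(ℝ, ℝ)) 𝓘(ℝ, ℝ) ∞ (fun p : M × ℝ ↦ F p.2 p.1) (univ ×ˢ Ico 0 T) → (∀ t ∈ Ico 0 T, ∀ x : M, 0 ≤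 f t x) → (∀ t ∈ Ico 0 T, ∀ x : M, 0 ≤ F t x) → (∀ t ∈ Ico 0 T, ∀ x : M, derivWithin (fun s ↦ f s x) (Ico 0 T) t ≤ (g t).laplaceBeltrami (f t) x - θ * F t x + Φf t x) → (∀ t ∈ Ico 0 T, ∀ x : M, derivWithin (fun s ↦ F s x) (Ico 0 T) t ≤ (g t).laplaceBeltrami (F t) x + ΦF t x) → ∀ (t₁ τ K a b A₀ : ℝ), t₁ ∈ Ico 0 T → 0 < τ → t₁ + τ < T → 0 ≤ K → 0 ≤ a → 0 ≤ b → K * τ ≤ 1 → (∀ x : M, f t₁ x ≤ A₀) → (∀ t ∈ Icc t₁ (t₁ + τ), ∀ x : M, Φf t x ≤ a) → (∀ t ∈ Icc t₁ (t₁ + τ), ∀ x : M, ΦF t x ≤ K * F t x + b) → ∀ t ∈ Icc t₁ (t₁ + τ), ∀ x : M, (t - t₁) * F t x ≤ 2 / θ * A₀ + τ * (τ * b + 2 * a / θ)) → ∃ δ₁ C₁ t₁ : ℝ, 0 < δ₁ ∧ t₁ ∈ Ico 0 T ∧ ∀ t ∈ Ico t₁ T, ∀ x : M, curvDerivNormSq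 (𝓡 4) g 1 t x ≤ C₁ * (T - t) ^ (δ₁ - 3) := by
  intro M _ _ _ _ _ _ g cov T hT hflow hR δ C t₀ hδ ht₀ hrate hshi hP hW
  -- the evolution inequality of `|∇Rm|²` with ONE constant (Topping (3.3.4), `k = 1`)
  have hS : UniqueDiffOn ℝ (Ico 0 T) := uniqueDiffOn_Ico 0 T
  have hS' : Ico 0 T ⊆ closure (interior (Ico 0 T)) := Ico_subset_closure_interior hT
  have h0T : (0 : ℝ) ∈ Ico 0 T := ⟨le_rfl, hT⟩
  obtain ⟨Cs, hCs0, hShi⟩ := hflow.derivWithin_curvDerivNormSq_le hS hS' hR h0T 1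
  obtain ⟨C₂, hC₂0, hPev⟩ := hP
  -- the curvature scale `|Rm|² = U_0 ≤ C_Q h⁻²`
  obtain ⟨CQ, tQ, htQ, hQ⟩ := hshi 0
  have hQ' : ∀ t ∈ Ico tQ T, ∀ x : M,
      (g t).curvNormSqWith (cov t) x ≤ CQ * ((T - t) ^ 2)⁻¹ := by
    intro t ht x
    have htT : t ∈ Ico 0 T := ⟨htQ.1.trans ht.1, ht.2⟩
    have h := hQ t ht x
    rwa [curvDerivNormSq_zero_eq (hR t htT) (hflow.isLeviCivita t htT), zero_add] at h
  -- nonnegativity of the round defect and of `|∇Rm|²`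
  have hP0 : ∀ t ∈ Ico 0 T, ∀ x : M, 0 ≤ (g t).curvNormSqWith (cov t) x -
      2 * (g t).scalarCurvatureWith (cov t) x / (3 * (T - t)) + 2 / (3 * (T - t) ^ 2) := by
    intro t ht x
    obtain ⟨hE, hWy⟩ := traceless_weyl_nonneg hflow hR ht x
    exact roundDefect_nonneg (sub_pos.2 ht.2) hE hWy
  have hF0 : ∀ t ∈ Ico 0 T, ∀ x : M, 0 ≤ curvDerivNormSq (𝓡 4) g 1 t x := fun t ht x ↦
    curvDerivNormSq_nonneg (hR t ht) 1 x
  -- the two evolution inequalities in the shape of the window lemma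
  have hfev : ∀ t ∈ Ico 0 T, ∀ x : M,
      derivWithin (fun s ↦ ((g s).curvNormSqWith (cov s) x -
        2 * (g s).scalarCurvatureWith (cov s) x / (3 * (T - s)) + 2 / (3 * (T - s) ^ 2))) (Ico 0 T) t ≤
      (g t).laplaceBeltrami (fun y ↦ (g t).curvNormSqWith (cov t) y -
        2 * (g t).scalarCurvatureWith (cov t) y / (3 * (T - t)) + 2 / (3 * (T - t) ^ 2)) x -
        2 * curvDerivNormSq (𝓡 4) g 1 t x +
      (C₂ * ((g t).curvNormSqWith (cov t) x + ((T - t) ^ 2)⁻¹) *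
          Real.sqrt |((g t).curvNormSqWith (cov t) x -
            2 * (g t).scalarCurvatureWith (cov t) x / (3 * (T - t)) + 2 / (3 * (T - t) ^ 2))| +
        C₂ * Real.sqrt ((g t).curvNormSqWith (cov t) x) *
          |((g t).curvNormSqWith (cov t) x -
            2 * (g t).scalarCurvatureWith (cov t) x / (3 * (T - t)) + 2 / (3 * (T - t) ^ 2))|) :=
    fun t ht x ↦ (hPev t ht x).trans_eq (add_assoc _ _ _)
  have hFev : ∀ t ∈ Ico 0 T, ∀ x : M,
      derivWithin (fun s ↦ curvDerivNormSq (𝓡 4) g 1 s x) (Ico 0 T) t ≤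
      (g t).laplaceBeltrami (curvDerivNormSq (𝓡 4) g 1 t) x +
        (-2 * curvDerivNormSq (𝓡 4) g (1 + 1) t x +
          Cs * (∑ p ∈ Finset.range (1 + 1), Real.sqrt (curvDerivNormSq (𝓡 4) g p t x) *
            Real.sqrt (curvDerivNormSq (𝓡 4) g (1 - p) t x)) *
            Real.sqrt (curvDerivNormSq (𝓡 4) g 1 t x) +
          Cs * Real.sqrt (curvDerivNormSq (𝓡 4) g 0 t x) * curvDerivNormSq (𝓡 4) g 1 t x) :=
    fun t ht x ↦ (hShi t ht x).trans_eq (by ring)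
  -- the window lemma for the pair `(P, |∇Rm|²)` with `θ = 2`
  have hwin := hW 2
    (fun t x ↦ (g t).curvNormSqWith (cov t) x -
      2 * (g t).scalarCurvatureWith (cov t) x / (3 * (T - t)) + 2 / (3 * (T - t) ^ 2))
    (curvDerivNormSq (𝓡 4) g 1)
    (fun t x ↦ C₂ * ((g t).curvNormSqWith (cov t) x + ((T - t) ^ 2)⁻¹) *
          Real.sqrt |((g t).curvNormSqWith (cov t) x -
            2 * (g t).scalarCurvatureWith (cov t) x / (3 * (T - t)) + 2 / (3 * (T - t) ^ 2))| +
        C₂ * Real.sqrt ((g t).curvNormSqWith (cov t) x) *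
          |((g t).curvNormSqWith (cov t) x -
            2 * (g t).scalarCurvatureWith (cov t) x / (3 * (T - t)) + 2 / (3 * (T - t) ^ 2))|)
    (fun t x ↦ -2 * curvDerivNormSq (𝓡 4) g (1 + 1) t x +
          Cs * (∑ p ∈ Finset.range (1 + 1), Real.sqrt (curvDerivNormSq (𝓡 4) g p t x) *
            Real.sqrt (curvDerivNormSq (𝓡 4) g (1 - p) t x)) *
            Real.sqrt (curvDerivNormSq (𝓡 4) g 1 t x) +
          Cs * Real.sqrt (curvDerivNormSq (𝓡 4) g 0 t x) * curvDerivNormSq (𝓡 4) g 1 t x)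
    two_pos (contMDiffOn_roundDefect hflow hT hR) (hflow.contMDiffOn_curvDerivNormSq hS hS' hR 1)
    hP0 hF0 hfev hFev
  -- the bookkeeping
  exact helper_curvDeriv_decayWindow M T δ C t₀ tQ CQ C₂ Cs _ _ _
    (fun t x ↦ (g t).curvNormSqWith (cov t) x -
      2 * (g t).scalarCurvatureWith (cov t) x / (3 * (T - t)) + 2 / (3 * (T - t) ^ 2)) _ _ _
    hδ ht₀ htQ hC₂0 hCs0 hrate hQ' (fun t x ↦ rfl) hP0 hF0 (fun t ht x ↦ le_rfl)
    (fun t ht x ↦ curvDeriv_one_reaction_le hflow hR ht x) hwin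

end Literature.Geometry.Riemannian.HamiltonPinchedFlow

end Part4

/-!
## Part 5 — port of `Summits/SmoothPoincare4/SmoothPoincare4/Theorems/EntropyRungChangGurskyYangStubSmoothRoundLimitDecayStep.lean` (7 declarations kept)

# Decay of the higher curvature derivatives of a round Type-I Ricci flow: the induction step (Hamilton 1982, §17, Thm. 17.6)

Declarations of this Part (verbatim port; each keeps its own docstring and citation): `decayAll_rpow_window_le`, `decayAll_sqrt_le`, `decayAll_mul_le`, `decayAll_phi_f_bound`, `decayAll_phi_F_bound`, `decayAll_window_arith`, `helper_curvDeriv_decay_step`.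

References: R. S. Hamilton, *Three-manifolds with positive Ricci curvature*, J. Differential Geom. 17 (1982) 255–306 [Hamilton1982]; P. Topping, *Lectures on the Ricci flow*, LMS Lecture Note Series 325, CUP 2006 [Topping2006].
-/

section Part5

open _root_.Set _root_.Function _root_.Filter
open scoped _root_.Manifold _root_.ContDiff _root_.Topology

namespace Literature.Geometry.Riemannian.HamiltonPinchedFlow

open Literature.Geometry.Riemannian
open Literature.Geometry.Lorentzian Literature.Geometry.Lorentzian.PseudoRiemannianMetric

/-! ### Real-variable lemmas -/

section RealLemmas

/-- Powers of comparable lengths compare: `h/2 ≤ h' ≤ 2h` and `2^{|e|} ≤ P` give `h'^e ≤ P h^e`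
(the bookkeeping between `h = T − t` and `h₁ = T − t₁` on a window). [cite: Hamilton1982, §17, Thm. 17.6] -/
theorem decayAll_rpow_window_le {h h' P : ℝ} (e : ℝ) (hh : 0 < h) (h1 : h / 2 ≤ h')
    (h2 : h' ≤ 2 * h) (hP : 2 ^ |e| ≤ P) : h' ^ e ≤ P * h ^ e := by
  have hh' : 0 < h' := by linarith
  refine le_trans ?_ (mul_le_mul_of_nonneg_right hP (Real.rpow_nonneg hh.le _))
  rcases le_or_gt 0 e with he | he
  · rw [abs_of_nonneg he, ← Real.mul_rpow zero_le_two hh.le]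
    exact Real.rpow_le_rpow hh'.le h2 he
  · rw [abs_of_neg he, Real.rpow_neg zero_le_two, ← Real.inv_rpow zero_le_two,
      ← Real.mul_rpow (inv_nonneg.2 zero_le_two) hh.le, show (2 : ℝ)⁻¹ * h = h / 2 by ring]
    exact Real.rpow_le_rpow_of_nonpos (by positivity) h1 he.le

/-- `u ≤ A h^e` with `A ≥ 1` gives `√u ≤ A h^{e/2}`. [cite: Hamilton1982, §17, Thm. 17.6] -/
theorem decayAll_sqrt_le {u A h e : ℝ} (hh : 0 < h) (hA : 1 ≤ A) (hu : u ≤ A * h ^ e) :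
    Real.sqrt u ≤ A * h ^ (e / 2) := by
  have hA0 : 0 ≤ A := zero_le_one.trans hA
  calc Real.sqrt u ≤ Real.sqrt (A * h ^ e) := Real.sqrt_le_sqrt hu
    _ = Real.sqrt A * h ^ (e / 2) := by
      rw [Real.sqrt_mul hA0, Real.sqrt_eq_rpow (h ^ e), ← Real.rpow_mul hh.le,
        show e * (1 / 2) = e / 2 by ring]
    _ ≤ A * h ^ (e / 2) := by
      refine mul_le_mul_of_nonneg_right ?_ (Real.rpow_nonneg hh.le _)
      rw [Real.sqrt_le_left hA0]
      nlinarith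

/-- Products of power bounds: `x ≤ A h^a`, `0 ≤ y ≤ B h^b`, `A ≥ 0` give `xy ≤ AB h^{a+b}`.
[cite: Hamilton1982, §17, Thm. 17.6] -/
theorem decayAll_mul_le {x y A B a b h : ℝ} (hh : 0 < h) (hx : x ≤ A * h ^ a) (hy : y ≤ B * h ^ b)
    (hy0 : 0 ≤ y) (hA : 0 ≤ A) : x * y ≤ A * B * h ^ (a + b) := by
  calc x * y ≤ (A * h ^ a) * (B * h ^ b) :=
        mul_le_mul hx hy hy0 (mul_nonneg hA (Real.rpow_nonneg hh.le _))
    _ = A * B * h ^ (a + b) := by rw [Real.rpow_add hh]; ring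

/-- **The reaction term of the evolution inequality for `U_{n+1}` decays** (Hamilton 1982, §17,
proof of Thm. 17.6): with the Shi bounds `u_p ≤ S h^{−p−2}` (`p ≤ n + 2`, `S ≥ 1`) and the decay
`u_{j+1} ≤ D h^{δ−j−3}` (`j ≤ n`, `D ≥ 1`, `0 < h ≤ 1`),
`C (Σ_{p ≤ n+1} √u_p √u_{n+1−p}) √u_{n+1} + C √u_0 u_{n+1} ≤ C((n+2)S²D + SD) h^{δ/2−n−4}`.
[cite: Hamilton1982, §17, Thm. 17.6] [cite: Topping2006, Thm. 3.3.1] -/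
theorem decayAll_phi_f_bound {n : ℕ} {u : ℕ → ℝ} {h S D δ C : ℝ} (hh : 0 < h) (hh1 : h ≤ 1)
    (hS : 1 ≤ S) (hD : 1 ≤ D) (hδ : 0 < δ) (hu0 : ∀ p, 0 ≤ u p)
    (huS : ∀ p ≤ n + 1 + 1, u p ≤ S * h ^ (-(p : ℝ) - 2))
    (huD : ∀ j ≤ n, u (j + 1) ≤ D * h ^ (δ - j - 3)) (hC : 0 ≤ C) :
    C * (∑ p ∈ Finset.range (n + 1 + 1), Real.sqrt (u p) * Real.sqrt (u (n + 1 - p))) *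
        Real.sqrt (u (n + 1)) + C * Real.sqrt (u 0) * u (n + 1) ≤
      C * ((n + 2) * S ^ 2 * D + S * D) * h ^ (δ / 2 - n - 4) := by
  have hS0 : 0 ≤ S := zero_le_one.trans hS
  have hr : ∀ p ≤ n + 1 + 1, Real.sqrt (u p) ≤ S * h ^ ((-(p : ℝ) - 2) / 2) := fun p hp ↦
    decayAll_sqrt_le hh hS (huS p hp)
  have hsum : ∑ p ∈ Finset.range (n + 1 + 1), Real.sqrt (u p) * Real.sqrt (u (n + 1 - p)) ≤
      (n + 2) * S ^ 2 * h ^ ((-(n : ℝ) - 5) / 2) := by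
    have hterm : ∀ p ∈ Finset.range (n + 1 + 1),
        Real.sqrt (u p) * Real.sqrt (u (n + 1 - p)) ≤ S * S * h ^ ((-(n : ℝ) - 5) / 2) := by
      intro p hp
      have hp' : p ≤ n + 1 := Nat.lt_succ_iff.mp (Finset.mem_range.mp hp)
      have h2 := hr (n + 1 - p) (by omega)
      rw [Nat.cast_sub hp'] at h2
      refine (decayAll_mul_le hh (hr p (by omega)) h2 (Real.sqrt_nonneg _) hS0).trans_eq ?_
      congr 2
      push_cast
      ring
    refine (Finset.sum_le_card_nsmul _ _ _ hterm).trans_eq ?_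
    rw [Finset.card_range, nsmul_eq_mul]
    push_cast
    ring
  have hlast : Real.sqrt (u (n + 1)) ≤ D * h ^ ((δ - n - 3) / 2) :=
    decayAll_sqrt_le hh hD (huD n le_rfl)
  have e1 : (∑ p ∈ Finset.range (n + 1 + 1), Real.sqrt (u p) * Real.sqrt (u (n + 1 - p))) *
      Real.sqrt (u (n + 1)) ≤ (n + 2) * S ^ 2 * D * h ^ (δ / 2 - n - 4) := by
    refine (decayAll_mul_le hh hsum hlast (Real.sqrt_nonneg _) (by positivity)).trans_eq ?_
    congr 2
    ring
  have e2 : Real.sqrt (u 0) * u (n + 1) ≤ S * D * h ^ (δ / 2 - n - 4) := by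
    refine (decayAll_mul_le hh (hr 0 (Nat.zero_le _)) (huD n le_rfl) (hu0 _) hS0).trans ?_
    refine mul_le_mul_of_nonneg_left (Real.rpow_le_rpow_of_exponent_ge hh hh1 ?_) (by positivity)
    push_cast
    linarith
  calc C * (∑ p ∈ Finset.range (n + 1 + 1), Real.sqrt (u p) * Real.sqrt (u (n + 1 - p))) *
          Real.sqrt (u (n + 1)) + C * Real.sqrt (u 0) * u (n + 1)
      = C * ((∑ p ∈ Finset.range (n + 1 + 1), Real.sqrt (u p) * Real.sqrt (u (n + 1 - p))) *
          Real.sqrt (u (n + 1))) + C * (Real.sqrt (u 0) * u (n + 1)) := by ring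
    _ ≤ C * ((n + 2) * S ^ 2 * D * h ^ (δ / 2 - n - 4)) + C * (S * D * h ^ (δ / 2 - n - 4)) :=
      add_le_add (mul_le_mul_of_nonneg_left e1 hC) (mul_le_mul_of_nonneg_left e2 hC)
    _ = C * ((n + 2) * S ^ 2 * D + S * D) * h ^ (δ / 2 - n - 4) := by ring

/-- **The reaction term of the evolution inequality for `U_{n+2}` is `≤ K U_{n+2} + b`** (Hamilton
1982, §17, proof of Thm. 17.6): with the Shi bounds (`p ≤ n + 2`) and the decay (`j ≤ n`), the end
terms `p = 0`, `p = n + 2` of the sum and the extra term give `3C √u_0 u_{n+2} ≤ 3CS h⁻¹ u_{n+2}`,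
the middle terms `C(n+1)DS² h^{δ/2−n−5}`, and `−2u_{n+3} ≤ 0`.
[cite: Hamilton1982, §17, Thm. 17.6] [cite: Topping2006, Thm. 3.3.1] -/
theorem decayAll_phi_F_bound {n : ℕ} {u : ℕ → ℝ} {h S D δ C : ℝ} (hh : 0 < h)
    (hS : 1 ≤ S) (hD : 1 ≤ D) (hu0 : ∀ p, 0 ≤ u p)
    (huS : ∀ p ≤ n + 1 + 1, u p ≤ S * h ^ (-(p : ℝ) - 2))
    (huD : ∀ j ≤ n, u (j + 1) ≤ D * h ^ (δ - j - 3)) (hC : 0 ≤ C) :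
    -2 * u (n + 1 + 1 + 1) + C * (∑ p ∈ Finset.range (n + 1 + 1 + 1), Real.sqrt (u p) *
        Real.sqrt (u (n + 1 + 1 - p))) * Real.sqrt (u (n + 1 + 1)) +
        C * Real.sqrt (u 0) * u (n + 1 + 1) ≤
      3 * C * S * (h ^ (-1 : ℝ) * u (n + 1 + 1)) +
        C * ((n + 1) * D * S ^ 2) * h ^ (δ / 2 - n - 5) := by
  have hS0 : 0 ≤ S := zero_le_one.trans hS
  have hD0 : 0 ≤ D := zero_le_one.trans hD
  have hr : ∀ p ≤ n + 1 + 1, Real.sqrt (u p) ≤ S * h ^ ((-(p : ℝ) - 2) / 2) := fun p hp ↦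
    decayAll_sqrt_le hh hS (huS p hp)
  have hrD : ∀ j ≤ n, Real.sqrt (u (j + 1)) ≤ D * h ^ ((δ - j - 3) / 2) := fun j hj ↦
    decayAll_sqrt_le hh hD (huD j hj)
  have hv0 : 0 ≤ Real.sqrt (u (n + 1 + 1)) := Real.sqrt_nonneg _
  have hvv : Real.sqrt (u (n + 1 + 1)) * Real.sqrt (u (n + 1 + 1)) = u (n + 1 + 1) :=
    Real.mul_self_sqrt (hu0 _)
  have hvS : Real.sqrt (u (n + 1 + 1)) ≤ S * h ^ ((-(n : ℝ) - 4) / 2) := by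
    refine (hr (n + 1 + 1) le_rfl).trans_eq ?_
    congr 2
    push_cast
    ring
  have h0 : Real.sqrt (u 0) ≤ S * h ^ (-1 : ℝ) := by
    refine (hr 0 (Nat.zero_le _)).trans_eq ?_
    congr 2
    push_cast
    ring
  -- the middle terms of the sum
  have hmid : ∑ p ∈ Finset.range (n + 1),
      Real.sqrt (u (p + 1)) * Real.sqrt (u (n + 1 + 1 - (p + 1))) ≤
      (n + 1) * (D * S) * h ^ ((δ - n - 6) / 2) := by
    have hterm : ∀ p ∈ Finset.range (n + 1),
        Real.sqrt (u (p + 1)) * Real.sqrt (u (n + 1 + 1 - (p + 1))) ≤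
          D * S * h ^ ((δ - n - 6) / 2) := by
      intro p hp
      have hp' : p ≤ n := Nat.lt_succ_iff.mp (Finset.mem_range.mp hp)
      have h2 := hr (n + 1 + 1 - (p + 1)) (by omega)
      rw [Nat.cast_sub (by omega : p + 1 ≤ n + 1 + 1)] at h2
      refine (decayAll_mul_le hh (hrD p hp') h2 (Real.sqrt_nonneg _) hD0).trans_eq ?_
      congr 2
      push_cast
      ring
    refine (Finset.sum_le_card_nsmul _ _ _ hterm).trans_eq ?_
    rw [Finset.card_range, nsmul_eq_mul]
    push_cast
    ring
  have e1 : (∑ p ∈ Finset.range (n + 1),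
      Real.sqrt (u (p + 1)) * Real.sqrt (u (n + 1 + 1 - (p + 1)))) * Real.sqrt (u (n + 1 + 1)) ≤
      (n + 1) * (D * S) * S * h ^ (δ / 2 - n - 5) := by
    refine (decayAll_mul_le hh hmid hvS hv0 (by positivity)).trans_eq ?_
    congr 2
    ring
  have e2 : Real.sqrt (u 0) * u (n + 1 + 1) ≤ S * h ^ (-1 : ℝ) * u (n + 1 + 1) :=
    mul_le_mul_of_nonneg_right h0 (hu0 _)
  have e3 := hu0 (n + 1 + 1 + 1)
  rw [Finset.sum_range_succ, Finset.sum_range_succ', Nat.sub_zero, Nat.sub_self]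
  have hsplit : C * (∑ p ∈ Finset.range (n + 1),
      Real.sqrt (u (p + 1)) * Real.sqrt (u (n + 1 + 1 - (p + 1))) +
      Real.sqrt (u 0) * Real.sqrt (u (n + 1 + 1)) + Real.sqrt (u (n + 1 + 1)) * Real.sqrt (u 0)) *
      Real.sqrt (u (n + 1 + 1)) =
      C * ((∑ p ∈ Finset.range (n + 1),
        Real.sqrt (u (p + 1)) * Real.sqrt (u (n + 1 + 1 - (p + 1)))) * Real.sqrt (u (n + 1 + 1))) +
        2 * C * (Real.sqrt (u 0) * u (n + 1 + 1)) := by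
    linear_combination (2 * C * Real.sqrt (u 0)) * hvv
  rw [hsplit]
  linarith [mul_le_mul_of_nonneg_left e1 hC, mul_le_mul_of_nonneg_left e2 hC]

/-- **The arithmetic of the window lemma at `t = t₁ + κh₁`**: from
`κh₁ u ≤ D₁ h₁^{d+1} + κh₁ (κh₁ · BP h₁^{e−1} + AP h₁^e)` with `h ≤ h₁ ≤ 2h`, `h₁ ≤ 1`, `e ≤ d`,
`2^{|e|} ≤ P`: `u ≤ (D₁/κ + κBP + AP) P h^e`. [cite: Hamilton1982, §17, Thm. 17.6] -/
theorem decayAll_window_arith {κ h h₁ D₁ B A P u d₀ d e eF : ℝ} (hκ : 0 < κ) (hh : 0 < h)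
    (hhh₁ : h ≤ h₁) (hh₁2 : h₁ ≤ 2 * h) (hh₁1 : h₁ ≤ 1) (hD : 0 ≤ D₁) (hB : 0 ≤ B) (hA : 0 ≤ A)
    (hP : 2 ^ |e| ≤ P) (hd₀ : d₀ = d + 1) (heF : e = eF + 1) (hed : e ≤ d)
    (hkey : κ * h₁ * u ≤ 2 / 2 * (D₁ * h₁ ^ d₀) +
      κ * h₁ * (κ * h₁ * (B * P * h₁ ^ eF) + 2 * (A * P * h₁ ^ e) / 2)) :
    u ≤ (D₁ * κ⁻¹ + κ * (B * P) + A * P) * P * h ^ e := by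
  have hh₁ : 0 < h₁ := hh.trans_le hhh₁
  have hP0 : 0 ≤ P := (Real.rpow_nonneg zero_le_two _).trans hP
  have hpow1 : h₁ ^ d₀ = h₁ ^ d * h₁ := by rw [hd₀, Real.rpow_add_one hh₁.ne']
  have hpow2 : h₁ ^ d ≤ h₁ ^ e := Real.rpow_le_rpow_of_exponent_ge hh₁ hh₁1 hed
  have hpow3 : h₁ * h₁ ^ eF = h₁ ^ e := by rw [heF, Real.rpow_add_one hh₁.ne', mul_comm]
  have hw : h₁ ^ e ≤ P * h ^ e := decayAll_rpow_window_le e hh (by linarith) hh₁2 hP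
  -- divide the window inequality by `τ = κ h₁`
  have k' : κ * h₁ * u ≤
      κ * h₁ * (D₁ * κ⁻¹ * h₁ ^ d + (κ * (B * P) * (h₁ * h₁ ^ eF) + A * P * h₁ ^ e)) := by
    have e1 : 2 / 2 * (D₁ * h₁ ^ d₀) = κ * h₁ * (D₁ * κ⁻¹ * h₁ ^ d) := by
      rw [hpow1, show κ * h₁ * (D₁ * κ⁻¹ * h₁ ^ d) = κ * κ⁻¹ * (D₁ * (h₁ ^ d * h₁)) by ring,
        mul_inv_cancel₀ hκ.ne']
      ring
    rw [e1] at hkey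
    linarith
  have k'' := le_of_mul_le_mul_left k' (mul_pos hκ hh₁)
  rw [hpow3] at k''
  have hsum : D₁ * κ⁻¹ * h₁ ^ d + (κ * (B * P) * h₁ ^ e + A * P * h₁ ^ e) ≤
      (D₁ * κ⁻¹ + κ * (B * P) + A * P) * h₁ ^ e := by
    have := mul_le_mul_of_nonneg_left hpow2 (mul_nonneg hD (inv_nonneg.2 hκ.le))
    linarith
  calc u ≤ _ := k''.trans hsum
    _ ≤ (D₁ * κ⁻¹ + κ * (B * P) + A * P) * (P * h ^ e) :=
      mul_le_mul_of_nonneg_left hw (by positivity)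
    _ = _ := by ring

end RealLemmas

/-! ### The induction step along the flow -/

/-- **HELPER — THE INDUCTION STEP OF Hamilton 1982, Thm. 17.6 (decay of `|∇^{n+2}Rm|²` from the
decay of `|∇Rm|², …, |∇^{n+1}Rm|²`).** Along a Ricci flow of Riemannian metrics on `[0, T)` on a
closed 4-manifold, GIVEN the Bernstein window lemma, the scaled Shi bounds
`U_p ≤ S (T−t)^{−p−2}` (`p ≤ n + 2`, `S ≥ 1`) on `[t_S, T)` and the decay
`U_{j+1} ≤ D (T−t)^{δ−j−3}` (`j ≤ n`, `δ > 0`) on `[t_D, T)`: `U_{n+2} ≤ C' (T−t)^{δ/2−n−4}` on some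
`[t', T)`. The window lemma with `θ = 2`, `f = U_{n+1}`, `F = U_{n+2}` (evolution inequalities
`IsRicciFlow.derivWithin_curvDerivNormSq_le`, joint smoothness
`IsRicciFlow.contMDiffOn_curvDerivNormSq`) on `[t₁, t₁ + κh₁]`, `h₁ = T − t₁ = (T − t)/(1 − κ)`,
`κ = min(1/2, 1/(6C₂S + 1))`, `K = 6C₂S/h₁`, `A₀ = D₁ h₁^{δ−n−3}`, with the reaction bounds
`decayAll_phi_f_bound`, `decayAll_phi_F_bound` and the arithmetic `decayAll_window_arith`.
[cite: Hamilton1982, §17, Thm. 17.6] [cite: Topping2006, Thm. 3.3.1] -/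
theorem helper_curvDeriv_decay_step : ∀ (M : Type) [TopologicalSpace M] [T2Space M] [SecondCountableTopology M] [ChartedSpace (EuclideanSpace ℝ (Fin 4)) M] [IsManifold (𝓡 4) ∞ M] [CompactSpace M] (g : ℝ → PseudoRiemannianMetric (𝓡 4) ∞ (EuclideanSpace ℝ (Fin 4)) (TangentSpace (𝓡 4) : M → Type _)) (cov : ℝ → CovariantDerivative (𝓡 4) (EuclideanSpace ℝ (Fin 4)) (TangentSpace (𝓡 4) : M → Type _)) (T : ℝ), 0 < T → IsRicciFlow g cov (Ico 0 T) → (∀ t ∈ Ico 0 T, (g t).IsRiemannian) → (∀ (θ : ℝ) (f F Φf ΦF : ℝ → M → ℝ), 0 < θ → ContMDiffOn ((𝓡 4).prod 𝓘(ℝ, ℝ)) 𝓘(ℝ, ℝ) ∞ (fun p : M × ℝ ↦ f p.2 p.1) (univ ×ˢ Ico 0 T) → ContMDiffOn ((𝓡 4).prod 𝓘(ℝ, ℝ)) 𝓘(ℝ, ℝ) ∞ (fun p : M × ℝ ↦ F p.2 p.1) (univ ×ˢ Ico 0 T) → (∀ t ∈ Ico 0 T, ∀ x : M, 0 ≤ f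 t x) → (∀ t ∈ Ico 0 T, ∀ x : M, 0 ≤ F t x) → (∀ t ∈ Ico 0 T, ∀ x : M, derivWithin (fun s ↦ f s x) (Ico 0 T) t ≤ (g t).laplaceBeltrami (f t) x - θ * F t x + Φf t x) → (∀ t ∈ Ico 0 T, ∀ x : M, derivWithin (fun s ↦ F s x) (Ico 0 T) t ≤ (g t).laplaceBeltrami (F t) x + ΦF t x) → ∀ (t₁ τ K a b A₀ : ℝ), t₁ ∈ Ico 0 T → 0 < τ → t₁ + τ < T → 0 ≤ K → 0 ≤ a → 0 ≤ b → K * τ ≤ 1 → (∀ x : M, f t₁ x ≤ A₀) → (∀ t ∈ Icc t₁ (t₁ + τ), ∀ x : M, Φf t x ≤ a) → (∀ t ∈ Icc t₁ (t₁ + τ), ∀ x : M, ΦF t x ≤ K * F t x + b) → ∀ t ∈ Icc t₁ (t₁ + τ), ∀ x : M, (t - t₁) * F t x ≤ 2 / θ * A₀ + τ * (τ * b + 2 * a / θ)) → ∀ (n : ℕ) (S tS δ D tD : ℝ), 1 ≤ S → tS ∈ Ico 0 T → (∀ p ≤ n + 2, ∀ t ∈ Ico tS T, ∀ z : M, curvDerivNormSq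 (𝓡 4) g p t z ≤ S * (T - t) ^ (-(p : ℝ) - 2)) → 0 < δ → tD ∈ Ico 0 T → (∀ j ≤ n, ∀ t ∈ Ico tD T, ∀ x : M, curvDerivNormSq (𝓡 4) g (j + 1) t x ≤ D * (T - t) ^ (δ - j - 3)) → ∃ C' t' : ℝ, t' ∈ Ico 0 T ∧ ∀ t ∈ Ico t' T, ∀ x : M, curvDerivNormSq (𝓡 4) g (n + 2) t x ≤ C' * (T - t) ^ (δ / 2 - n - 4) := by
  intro M _ _ _ _ _ _ g cov T hT hflow hR hW n S tS δ D tD hS1 htS hShi hδ htD hDec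
  have hS : UniqueDiffOn ℝ (Ico 0 T) := uniqueDiffOn_Ico 0 T
  have hS' := Ico_subset_closure_interior hT
  have h0 : (0 : ℝ) ∈ Ico 0 T := ⟨le_rfl, hT⟩
  have hUnn : ∀ j, ∀ s ∈ Ico 0 T, ∀ z : M, 0 ≤ curvDerivNormSq (𝓡 4) g j s z := fun j s hs z ↦
    curvDerivNormSq_nonneg (hR s hs) j z
  have hS0 : 0 ≤ S := zero_le_one.trans hS1
  -- the evolution inequalities for `U_{n+1}` and `U_{n+2}`
  obtain ⟨C₁, hC₁0, hev₁⟩ := hflow.derivWithin_curvDerivNormSq_le hS hS' hR h0 (n + 1)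
  obtain ⟨C₂, hC₂0, hev₂⟩ := hflow.derivWithin_curvDerivNormSq_le hS hS' hR h0 (n + 1 + 1)
  -- `D₁ ≥ 1` and the late time `tst`
  obtain ⟨D₁, hD₁1, hDD₁⟩ : ∃ D₁ : ℝ, 1 ≤ D₁ ∧ D ≤ D₁ := ⟨max D 1, le_max_right _ _, le_max_left _ _⟩
  have hD₁0 : 0 ≤ D₁ := zero_le_one.trans hD₁1
  obtain ⟨tst, htst0, htstS, htstD, htst2⟩ :
      ∃ tst : ℝ, tst ∈ Ico 0 T ∧ tS ≤ tst ∧ tD ≤ tst ∧ T - tst ≤ 1 / 2 :=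
    ⟨max (max tS tD) (T - 1 / 2), ⟨le_max_of_le_left (le_max_of_le_left htS.1),
      max_lt (max_lt htS.2 htD.2) (by linarith)⟩, le_max_of_le_left (le_max_left _ _),
      le_max_of_le_left (le_max_right _ _), by linarith [le_max_right (max tS tD) (T - 1 / 2)]⟩
  have hlate : ∀ s ∈ Ico tst T, s ∈ Ico 0 T ∧
      (∀ p ≤ n + 1 + 1, ∀ x : M, curvDerivNormSq (𝓡 4) g p s x ≤ S * (T - s) ^ (-(p : ℝ) - 2)) ∧
      (∀ j ≤ n, ∀ x : M, curvDerivNormSq (𝓡 4) g (j + 1) s x ≤ D₁ * (T - s) ^ (δ - j - 3)) :=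
    fun s hs ↦ ⟨⟨htst0.1.trans hs.1, hs.2⟩, fun p hp x ↦ hShi p hp s ⟨htstS.trans hs.1, hs.2⟩ x,
      fun j hj x ↦ (hDec j hj s ⟨htstD.trans hs.1, hs.2⟩ x).trans
        (mul_le_mul_of_nonneg_right hDD₁ (Real.rpow_nonneg (sub_pos.2 hs.2).le _))⟩
  -- the reaction terms and their bounds at late times
  obtain ⟨Φf, hΦf⟩ : ∃ Φf : ℝ → M → ℝ, Φf = fun s y ↦
      C₁ * (∑ p ∈ Finset.range (n + 1 + 1), Real.sqrt (curvDerivNormSq (𝓡 4) g p s y) *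
        Real.sqrt (curvDerivNormSq (𝓡 4) g (n + 1 - p) s y)) *
        Real.sqrt (curvDerivNormSq (𝓡 4) g (n + 1) s y) +
        C₁ * Real.sqrt (curvDerivNormSq (𝓡 4) g 0 s y) * curvDerivNormSq (𝓡 4) g (n + 1) s y :=
    ⟨_, rfl⟩
  obtain ⟨ΦF, hΦF⟩ : ∃ ΦF : ℝ → M → ℝ, ΦF = fun s y ↦
      -2 * curvDerivNormSq (𝓡 4) g (n + 1 + 1 + 1) s y +
      C₂ * (∑ p ∈ Finset.range (n + 1 + 1 + 1), Real.sqrt (curvDerivNormSq (𝓡 4) g p s y) *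
        Real.sqrt (curvDerivNormSq (𝓡 4) g (n + 1 + 1 - p) s y)) *
        Real.sqrt (curvDerivNormSq (𝓡 4) g (n + 1 + 1) s y) +
        C₂ * Real.sqrt (curvDerivNormSq (𝓡 4) g 0 s y) * curvDerivNormSq (𝓡 4) g (n + 1 + 1) s y :=
    ⟨_, rfl⟩
  obtain ⟨Af, hAf0, hAf⟩ : ∃ Af : ℝ, 0 ≤ Af ∧ ∀ s ∈ Ico tst T, ∀ y : M,
      Φf s y ≤ Af * (T - s) ^ (δ / 2 - n - 4) := by
    refine ⟨C₁ * ((n + 2) * S ^ 2 * D₁ + S * D₁), by positivity, fun s hs y ↦ ?_⟩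
    obtain ⟨hs0, hSb, hDb⟩ := hlate s hs
    rw [hΦf]
    exact decayAll_phi_f_bound (u := fun p ↦ curvDerivNormSq (𝓡 4) g p s y) (sub_pos.2 hs.2)
      (by linarith [hs.1]) hS1 hD₁1 hδ (fun p ↦ hUnn p s hs0 y) (fun p hp ↦ hSb p hp y)
      (fun j hj ↦ hDb j hj y) hC₁0
  obtain ⟨BF, hBF0, hBF⟩ : ∃ BF : ℝ, 0 ≤ BF ∧ ∀ s ∈ Ico tst T, ∀ y : M, ΦF s y ≤
      3 * C₂ * S * ((T - s) ^ (-1 : ℝ) * curvDerivNormSq (𝓡 4) g (n + 1 + 1) s y) +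
        BF * (T - s) ^ (δ / 2 - n - 5) := by
    refine ⟨C₂ * ((n + 1) * D₁ * S ^ 2), by positivity, fun s hs y ↦ ?_⟩
    obtain ⟨hs0, hSb, hDb⟩ := hlate s hs
    rw [hΦF]
    exact decayAll_phi_F_bound (u := fun p ↦ curvDerivNormSq (𝓡 4) g p s y) (sub_pos.2 hs.2)
      hS1 hD₁1 (fun p ↦ hUnn p s hs0 y) (fun p hp ↦ hSb p hp y) (fun j hj ↦ hDb j hj y) hC₂0
  -- the window lemma for `f = U_{n+1}`, `F = U_{n+2}`, `θ = 2`
  have hWf := hW 2 (curvDerivNormSq (𝓡 4) g (n + 1)) (curvDerivNormSq (𝓡 4) g (n + 1 + 1)) Φf ΦF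
    two_pos (hflow.contMDiffOn_curvDerivNormSq hS hS' hR (n + 1))
    (hflow.contMDiffOn_curvDerivNormSq hS hS' hR (n + 1 + 1))
    (fun s hs y ↦ hUnn _ s hs y) (fun s hs y ↦ hUnn _ s hs y)
    (fun s hs y ↦ by simp only [hΦf]; linarith [hev₁ s hs y])
    (fun s hs y ↦ by simp only [hΦF]; linarith [hev₂ s hs y])
  -- the window fraction `κ`, the factor `P`, the output
  obtain ⟨κ, hκ0, hκ2, hκK⟩ : ∃ κ : ℝ, 0 < κ ∧ κ ≤ 1 / 2 ∧ 6 * C₂ * S * κ ≤ 1 := by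
    refine ⟨min (1 / 2) (1 / (6 * C₂ * S + 1)), lt_min (by norm_num) (by positivity),
      min_le_left _ _, ?_⟩
    have h1 : min (1 / 2) (1 / (6 * C₂ * S + 1)) ≤ 1 / (6 * C₂ * S + 1) := min_le_right _ _
    rw [le_div_iff₀ (by positivity)] at h1
    nlinarith [mul_nonneg (mul_nonneg (by norm_num : (0 : ℝ) ≤ 6) hC₂0) hS0,
      le_min (by norm_num : (0 : ℝ) ≤ 1 / 2) (by positivity : (0 : ℝ) ≤ 1 / (6 * C₂ * S + 1))]
  obtain ⟨P, hPf, hPF⟩ : ∃ P : ℝ, (2 : ℝ) ^ |δ / 2 - n - 4| ≤ P ∧ (2 : ℝ) ^ |δ / 2 - n - 5| ≤ P :=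
    ⟨max (2 ^ |δ / 2 - n - 4|) (2 ^ |δ / 2 - n - 5|), le_max_left _ _, le_max_right _ _⟩
  have hP0 : 0 ≤ P := (Real.rpow_nonneg zero_le_two _).trans hPf
  refine ⟨(D₁ * κ⁻¹ + κ * (BF * P) + Af * P) * P, (T + tst) / 2,
    ⟨by linarith [htst0.1], by linarith [htst0.2]⟩, fun t ht x ↦ ?_⟩
  -- the window `[t₁, t]`: `T − t₁ = h₁ = (T − t)/(1 − κ)`, `t = t₁ + κ h₁`
  have htT : t < T := ht.2
  have hh : 0 < T - t := sub_pos.2 htT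
  have h1κ : 0 < 1 - κ := by linarith
  obtain ⟨h₁, hh₁def⟩ : ∃ h₁ : ℝ, h₁ = (T - t) / (1 - κ) := ⟨_, rfl⟩
  have hh₁ : 0 < h₁ := by rw [hh₁def]; exact div_pos hh h1κ
  have hκh₁ : (1 - κ) * h₁ = T - t := by rw [hh₁def]; field_simp
  have hhh₁ : T - t ≤ h₁ := by nlinarith [mul_nonneg hκ0.le hh₁.le]
  have hh₁2 : h₁ ≤ 2 * (T - t) := by nlinarith [mul_le_mul_of_nonneg_right hκ2 hh₁.le]
  have hh₁1 : h₁ ≤ 1 := by linarith [ht.1]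
  obtain ⟨t₁, ht₁def⟩ : ∃ t₁ : ℝ, t₁ = T - h₁ := ⟨_, rfl⟩
  have hTt₁ : T - t₁ = h₁ := by rw [ht₁def]; ring
  have ht₁τ : t₁ + κ * h₁ = t := by rw [ht₁def]; linarith
  have ht₁tst : tst ≤ t₁ := by rw [ht₁def]; linarith [ht.1]
  have ht₁T : t₁ < T := by rw [ht₁def]; linarith
  have hwin : ∀ s ∈ Icc t₁ (t₁ + κ * h₁), s ∈ Ico tst T ∧ h₁ / 2 ≤ T - s ∧ T - s ≤ 2 * h₁ := by
    intro s hs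
    refine ⟨⟨ht₁tst.trans hs.1, by linarith [hs.2]⟩, ?_, by linarith [hs.1]⟩
    nlinarith [hs.2, mul_le_mul_of_nonneg_right hκ2 hh₁.le]
  -- the hypotheses of the window lemma on `[t₁, t₁ + κ h₁]`
  have hKτ : 6 * C₂ * S / h₁ * (κ * h₁) ≤ 1 := by
    calc 6 * C₂ * S / h₁ * (κ * h₁) = 6 * C₂ * S * κ * (h₁ / h₁) := by ring
      _ ≤ 1 := by rw [div_self hh₁.ne', mul_one]; exact hκK
  have hA₀ : ∀ y : M, curvDerivNormSq (𝓡 4) g (n + 1) t₁ y ≤ D₁ * h₁ ^ (δ - n - 3) := by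
    intro y
    have h := (hlate t₁ ⟨ht₁tst, ht₁T⟩).2.2 n le_rfl y
    rwa [hTt₁] at h
  have ha : ∀ s ∈ Icc t₁ (t₁ + κ * h₁), ∀ y : M, Φf s y ≤ Af * P * h₁ ^ (δ / 2 - n - 4) := by
    intro s hs y
    obtain ⟨hs', hlo, hhi⟩ := hwin s hs
    calc Φf s y ≤ Af * (T - s) ^ (δ / 2 - n - 4) := hAf s hs' y
      _ ≤ Af * (P * h₁ ^ (δ / 2 - n - 4)) :=
        mul_le_mul_of_nonneg_left (decayAll_rpow_window_le _ hh₁ hlo hhi hPf) hAf0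
      _ = Af * P * h₁ ^ (δ / 2 - n - 4) := by ring
  have hb : ∀ s ∈ Icc t₁ (t₁ + κ * h₁), ∀ y : M, ΦF s y ≤
      6 * C₂ * S / h₁ * curvDerivNormSq (𝓡 4) g (n + 1 + 1) s y + BF * P * h₁ ^ (δ / 2 - n - 5) := by
    intro s hs y
    obtain ⟨hs', hlo, hhi⟩ := hwin s hs
    have hu := hUnn (n + 1 + 1) s (hlate s hs').1 y
    have hinv : (T - s) ^ (-1 : ℝ) ≤ 2 / h₁ := by
      calc (T - s) ^ (-1 : ℝ) = (T - s)⁻¹ := Real.rpow_neg_one _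
        _ ≤ (h₁ / 2)⁻¹ := inv_anti₀ (by positivity) hlo
        _ = 2 / h₁ := inv_div _ _
    calc ΦF s y ≤ _ := hBF s hs' y
      _ ≤ 3 * C₂ * S * (2 / h₁ * curvDerivNormSq (𝓡 4) g (n + 1 + 1) s y) +
          BF * (P * h₁ ^ (δ / 2 - n - 5)) :=
        add_le_add (mul_le_mul_of_nonneg_left (mul_le_mul_of_nonneg_right hinv hu) (by positivity))
          (mul_le_mul_of_nonneg_left (decayAll_rpow_window_le _ hh₁ hlo hhi hPF) hBF0)
      _ = _ := by ring
  -- the window lemma at `t = t₁ + κ h₁` and the arithmetic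
  have key := hWf t₁ (κ * h₁) (6 * C₂ * S / h₁) (Af * P * h₁ ^ (δ / 2 - n - 4))
    (BF * P * h₁ ^ (δ / 2 - n - 5)) (D₁ * h₁ ^ (δ - n - 3)) ⟨htst0.1.trans ht₁tst, ht₁T⟩
    (mul_pos hκ0 hh₁) (by rw [ht₁τ]; exact htT) (by positivity) (by positivity) (by positivity)
    hKτ hA₀ ha hb t ⟨by nlinarith [mul_pos hκ0 hh₁], ht₁τ.ge⟩ x
  rw [show t - t₁ = κ * h₁ by linarith] at key
  exact decayAll_window_arith (d := δ - n - 4) hκ0 hh hhh₁ hh₁2 hh₁1 hD₁0 hBF0 hAf0 hPf (by ring)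
    (by ring) (by linarith) key

end Literature.Geometry.Riemannian.HamiltonPinchedFlow

end Part5

/-!
## Part 6 — port of `Summits/SmoothPoincare4/SmoothPoincare4/Theorems/EntropyRungChangGurskyYangStubSmoothRoundLimitDecayAll.lean` (2 declarations kept)

# Decay of all higher curvature derivatives of a round Type-I Ricci flow (Hamilton 1982, Thm. 17.6)

Declarations of this Part (verbatim port; each keeps its own docstring and citation): `decayAll_shi_uniform`, `helper_curvDeriv_decay_all`.

References: R. S. Hamilton, *Three-manifolds with positive Ricci curvature*, J. Differential Geom. 17 (1982) 255–306 [Hamilton1982]; P. Topping, *Lectures on the Ricci flow*, LMS Lecture Note Series 325, CUP 2006 [Topping2006].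
-/

section Part6

open _root_.Set _root_.Function _root_.Filter
open scoped _root_.Manifold _root_.ContDiff _root_.Topology

namespace Literature.Geometry.Riemannian.HamiltonPinchedFlow

open Literature.Geometry.Riemannian
open Literature.Geometry.Lorentzian Literature.Geometry.Lorentzian.PseudoRiemannianMetric

/-- **Uniform scaled Shi bounds up to a fixed order**: from `U_k ≤ C_k ((T−t)^{k+2})⁻¹` on
`[t_k, T)` for every `k`, one constant `S ≥ 1` and one late time serve all `p ≤ n`, in real-power
form `U_p ≤ S (T−t)^{−p−2}`. [cite: Topping2006, Thm. 3.3.1] -/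
theorem decayAll_shi_uniform {α : Type*} {F : ℕ → ℝ → α → ℝ} {T : ℝ}
    (hshi : ∀ k : ℕ, ∃ C' t₁ : ℝ, t₁ ∈ Ico 0 T ∧ ∀ t ∈ Ico t₁ T, ∀ z : α,
      F k t z ≤ C' * ((T - t) ^ (k + 2))⁻¹) (n : ℕ) :
    ∃ S t₁ : ℝ, 1 ≤ S ∧ t₁ ∈ Ico 0 T ∧ ∀ p ≤ n, ∀ t ∈ Ico t₁ T, ∀ z : α,
      F p t z ≤ S * (T - t) ^ (-(p : ℝ) - 2) := by
  -- one bound in real-power form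
  have hconv : ∀ (p : ℕ) (C' t : ℝ) (z : α), t < T → F p t z ≤ C' * ((T - t) ^ (p + 2))⁻¹ →
      ∀ S, C' ≤ S → F p t z ≤ S * (T - t) ^ (-(p : ℝ) - 2) := by
    intro p C' t z ht hb S hS
    have hh : 0 < T - t := sub_pos.2 ht
    have heq : (T - t) ^ (-(p : ℝ) - 2) = ((T - t) ^ (p + 2))⁻¹ := by
      rw [show (-(p : ℝ) - 2) = -((p + 2 : ℕ) : ℝ) by push_cast; ring, Real.rpow_neg hh.le,
        Real.rpow_natCast]
    rw [heq]
    exact hb.trans (mul_le_mul_of_nonneg_right hS (inv_nonneg.2 (pow_nonneg hh.le _)))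
  induction n with
  | zero =>
    obtain ⟨C', t₁, ht₁, hb⟩ := hshi 0
    refine ⟨max C' 1, t₁, le_max_right _ _, ht₁, fun p hp t ht z ↦ ?_⟩
    obtain rfl : p = 0 := Nat.le_zero.mp hp
    exact hconv 0 C' t z ht.2 (hb t ht z) _ (le_max_left _ _)
  | succ n ih =>
    obtain ⟨S, t₁, hS, ht₁, hb⟩ := ih
    obtain ⟨C', t₂, ht₂, hb'⟩ := hshi (n + 1)
    refine ⟨max S C', max t₁ t₂, le_max_of_le_left hS,
      ⟨le_max_of_le_left ht₁.1, max_lt ht₁.2 ht₂.2⟩, fun p hp t ht z ↦ ?_⟩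
    rcases Nat.of_le_succ hp with hpn | rfl
    · have ht' : t ∈ Ico t₁ T := ⟨(le_max_left _ _).trans ht.1, ht.2⟩
      exact (hb p hpn t ht' z).trans (mul_le_mul_of_nonneg_right (le_max_left _ _)
        (Real.rpow_nonneg (sub_pos.2 ht.2).le _))
    · have ht' : t ∈ Ico t₂ T := ⟨(le_max_right _ _).trans ht.1, ht.2⟩
      exact hconv (n + 1) C' t z ht.2 (hb' t ht' z) _ (le_max_right _ _)

/-- **HELPER S3c — DECAY OF ALL HIGHER CURVATURE DERIVATIVES (Hamilton 1982, §17, Thm. 17.6; Shi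
1989, §7, in maximum-principle form).** Along a Ricci flow of Riemannian metrics on `[0, T)` on a
closed 4-manifold with the roundness rates, GIVEN the scaled Shi bounds `|∇ᵏRm|² ≤ C_k (T−t)^{−k−2}`,
the Bernstein window lemma and the decay `|∇Rm|² ≤ C₁ (T−t)^{δ₁−3}`, for every `k` there are
`δ' > 0`, `C'`, `t' ∈ [0, T)` with `|∇^{k+1}Rm|² ≤ C' (T−t)^{δ'−k−3}` on `M × [t', T)`. Proof:
induction on `k` with uniform constants for `U_1, …, U_{k+1}` (base: the hypothesis; step:
`helper_curvDeriv_decay_step` with `decayAll_shi_uniform`, halving `δ'` and comparing powers of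
`T − t ≤ 1`). [cite: Hamilton1982, §17, Thm. 17.6] [cite: Topping2006, Thm. 3.3.1] -/
theorem helper_curvDeriv_decay_all : ∀ (M : Type) [TopologicalSpace M] [T2Space M] [SecondCountableTopology M] [ChartedSpace (EuclideanSpace ℝ (Fin 4)) M] [IsManifold (𝓡 4) ∞ M] [CompactSpace M] (g : ℝ → PseudoRiemannianMetric (𝓡 4) ∞ (EuclideanSpace ℝ (Fin 4)) (TangentSpace (𝓡 4) : M → Type _)) (cov : ℝ → CovariantDerivative (𝓡 4) (EuclideanSpace ℝ (Fin 4)) (TangentSpace (𝓡 4) : M → Type _)) (T : ℝ), 0 < T → IsRicciFlow g cov (Ico 0 T) → (∀ t ∈ Ico 0 T, (g t).IsRiemannian) → ∀ (δ C t₀ : ℝ), 0 < δ → t₀ ∈ Ico 0 T → (∀ t ∈ Ico t₀ T, ∀ x : M, |(T - t) * (g t).scalarCurvatureWith (cov t) x - 2| ≤ C * (T - t) ^ δ ∧ (T - t) ^ 2 * ((g t).normSq x ((cov t).ricci x) - (g t).scalarCurvatureWith (cov t) x ^ 2 / 4) ≤ C * (T - t) ^ (2 * δ) ∧ (T - t)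 ^ 2 * ((g t).curvNormSqWith (cov t) x - 2 * (g t).normSq x ((cov t).ricci x) + (g t).scalarCurvatureWith (cov t) x ^ 2 / 3) ≤ C * (T - t) ^ δ) → (∀ k : ℕ, ∃ C' t₁ : ℝ, t₁ ∈ Ico 0 T ∧ ∀ t ∈ Ico t₁ T, ∀ z : M, curvDerivNormSq (𝓡 4) g k t z ≤ C' * ((T - t) ^ (k + 2))⁻¹) → (∀ (θ : ℝ) (f F Φf ΦF : ℝ → M → ℝ), 0 < θ → ContMDiffOn ((𝓡 4).prod 𝓘(ℝ, ℝ)) 𝓘(ℝ, ℝ) ∞ (fun p : M × ℝ ↦ f p.2 p.1) (univ ×ˢ Ico 0 T) → ContMDiffOn ((𝓡 4).prod 𝓘(ℝ, ℝ)) 𝓘(ℝ, ℝ) ∞ (fun p : M × ℝ ↦ F p.2 p.1) (univ ×ˢ Ico 0 T) → (∀ t ∈ Ico 0 T, ∀ x : M, 0 ≤ f t x) → (∀ t ∈ Ico 0 T, ∀ x : M, 0 ≤ F t x) → (∀ t ∈ Ico 0 T, ∀ x : M, derivWithin (fun s ↦ f s x) (Ico 0 T) t ≤ (g t).laplaceBeltrami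 (f t) x - θ * F t x + Φf t x) → (∀ t ∈ Ico 0 T, ∀ x : M, derivWithin (fun s ↦ F s x) (Ico 0 T) t ≤ (g t).laplaceBeltrami (F t) x + ΦF t x) → ∀ (t₁ τ K a b A₀ : ℝ), t₁ ∈ Ico 0 T → 0 < τ → t₁ + τ < T → 0 ≤ K → 0 ≤ a → 0 ≤ b → K * τ ≤ 1 → (∀ x : M, f t₁ x ≤ A₀) → (∀ t ∈ Icc t₁ (t₁ + τ), ∀ x : M, Φf t x ≤ a) → (∀ t ∈ Icc t₁ (t₁ + τ), ∀ x : M, ΦF t x ≤ K * F t x + b) → ∀ t ∈ Icc t₁ (t₁ + τ), ∀ x : M, (t - t₁) * F t x ≤ 2 / θ * A₀ + τ * (τ * b + 2 * a / θ)) → (∃ δ₁ C₁ t₁ : ℝ, 0 < δ₁ ∧ t₁ ∈ Ico 0 T ∧ ∀ t ∈ Ico t₁ T, ∀ x : M, curvDerivNormSq (𝓡 4) g 1 t x ≤ C₁ * (T - t) ^ (δ₁ - 3)) → ∀ k : ℕ, ∃ δ' C' t' : ℝ, 0 < δ' ∧ t' ∈ Ico 0 T ∧ ∀ t ∈ Ico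 t' T, ∀ x : M, curvDerivNormSq (𝓡 4) g (k + 1) t x ≤ C' * (T - t) ^ (δ' - k - 3) := by
  intro M _ _ _ _ _ _ g cov T hT hflow hR _ _ _ _ _ _ hshi hW h1 k
  -- uniform decay of `U_1, …, U_{k+1}` by induction on `k`
  have main : ∀ k : ℕ, ∃ δ' C' t' : ℝ, 0 < δ' ∧ t' ∈ Ico 0 T ∧ ∀ j ≤ k, ∀ t ∈ Ico t' T, ∀ x : M,
      curvDerivNormSq (𝓡 4) g (j + 1) t x ≤ C' * (T - t) ^ (δ' - j - 3) := by
    intro k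
    induction k with
    | zero =>
      obtain ⟨δ₁, C₁, t₁, hδ₁, ht₁, hb⟩ := h1
      refine ⟨δ₁, C₁, t₁, hδ₁, ht₁, fun j hj t ht x ↦ ?_⟩
      obtain rfl : j = 0 := Nat.le_zero.mp hj
      simpa only [Nat.cast_zero, sub_zero, zero_add] using hb t ht x
    | succ k ih =>
      obtain ⟨δ', C', t', hδ', ht', hb⟩ := ih
      obtain ⟨S, tS, hS1, htS, hShi⟩ := decayAll_shi_uniform hshi (k + 2)
      obtain ⟨C'', t'', ht'', hb''⟩ := helper_curvDeriv_decay_step M g cov T hT hflow hR hW k S tS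
        δ' C' t' hS1 htS hShi hδ' ht' hb
      refine ⟨δ' / 2, max (max C' C'') 0, max (max t' t'') (T - 1), half_pos hδ',
        ⟨le_max_of_le_left (le_max_of_le_left ht'.1), max_lt (max_lt ht'.2 ht''.2) (by linarith)⟩,
        fun j hj t ht x ↦ ?_⟩
      have htT : 0 < T - t := sub_pos.2 ht.2
      have ht1 : T - t ≤ 1 := by linarith [(le_max_right (max t' t'') (T - 1)).trans ht.1]
      have hC0 : 0 ≤ max (max C' C'') 0 := le_max_right _ _
      rcases Nat.of_le_succ hj with hjk | rfl
      · have htj : t ∈ Ico t' T := ⟨((le_max_left _ _).trans (le_max_left _ _)).trans ht.1, ht.2⟩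
        calc _ ≤ C' * (T - t) ^ (δ' - j - 3) := hb j hjk t htj x
          _ ≤ max (max C' C'') 0 * (T - t) ^ (δ' - j - 3) :=
            mul_le_mul_of_nonneg_right ((le_max_left _ _).trans (le_max_left _ _))
              (Real.rpow_nonneg htT.le _)
          _ ≤ max (max C' C'') 0 * (T - t) ^ (δ' / 2 - j - 3) :=
            mul_le_mul_of_nonneg_left (Real.rpow_le_rpow_of_exponent_ge htT ht1 (by linarith)) hC0
      · have htj : t ∈ Ico t'' T := ⟨((le_max_right _ _).trans (le_max_left _ _)).trans ht.1, ht.2⟩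
        calc _ ≤ C'' * (T - t) ^ (δ' / 2 - k - 4) := hb'' t htj x
          _ ≤ max (max C' C'') 0 * (T - t) ^ (δ' / 2 - k - 4) :=
            mul_le_mul_of_nonneg_right ((le_max_right _ _).trans (le_max_left _ _))
              (Real.rpow_nonneg htT.le _)
          _ = max (max C' C'') 0 * (T - t) ^ (δ' / 2 - ↑(k + 1) - 3) := by
            congr 1
            push_cast
            ring
  obtain ⟨δ', C', t', hδ', ht', hb⟩ := main k
  exact ⟨δ', C', t', hδ', ht', fun t ht x ↦ hb k le_rfl t ht x⟩

end Literature.Geometry.Riemannian.HamiltonPinchedFlow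

end Part6

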